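import Mathlib.LinearAlgebra.Matrix.Determinant.Basic
import Mathlib.LinearAlgebra.Matrix.NonsingularInverse
import Mathlib.Data.Matrix.Mul
import Mathlib.Tactic
import Mathlib.NumberTheory.Padics.RingHoms
import Mathlib.LinearAlgebra.Matrix.ToLinearEquiv
import Literature.RepresentationTheory.FiniteGroups.InvariantLineOfFixedVectors
import HarnessLib

/-!
# Katz's lattice theorem: `det(1 − g) ≡ 0 (mod ℓⁿ)` on a compact subgroup of `GL₂(ℚ_ℓ)` is
# explained by a trivial subquotient of order `ℓⁿ`

Topic `Literature/NumberTheory/GaloisRepresentations`; theorems only (no definition, no named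
fact). N. M. Katz, *Galois properties of torsion points on abelian varieties*, Invent. Math. 62
(1981) 481–502, **Theorem 1** (restated as Cullinan–Kenney–Voight 2022, Thm. 2.3.1, and
arXiv:2602.21047, Thm. 3.1): *let `V` be a plane over `ℚ_ℓ`, `G ≤ Aut(V)` compact and `n ≥ 1`
with `det(1 − g) ≡ 0 (mod ℓⁿ)` for all `g ∈ G`; then in a suitable basis
`G ≤ G(n; a, b) = {(1 + ℓᵃ*, ℓᵃ*; ℓᵇ*, 1 + ℓᵇ*)}` for some `a + b = n`, i.e. there are `G`-stable
lattices `𝓛' ⊆ 𝓛` with `𝓛/𝓛' ≅ ℤ/ℓᵃ × ℤ/ℓᵇ` of order `ℓⁿ` and trivial `G`-action.*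

We prove it in matrix form (`katz_exists_lattice_of_det_one_sub_dvd`,
`katz_exists_monoidHom_of_det_one_sub_dvd`): for a group `Γ` and a homomorphism
`ρ : Γ →* M₂(ℤ_ℓ)` (a compact `G` stabilises a lattice, which gives such a `ρ`) with
`ℓⁿ ∣ det(1 − ρ γ)` for all `γ`, there are `P ∈ M₂(ℤ_ℓ)`, `det P ≠ 0`, and `a + b = n` with
`ρ γ · P = P · X_γ`, `X_γ ≡ 1` in the sense `ℓᵃ ∣ X₀₀ − 1, X₀₁` and `ℓᵇ ∣ X₁₀, X₁₁ − 1` ("shape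
`(a, b)`", always written out; the columns of `P` span `𝓛`, those of `P diag(ℓᵃ, ℓᵇ)` span `𝓛'`).

## The proof (Katz's induction on `n`, loc. cit. pp. 484–487)

Suppose `ρ` has shape `(a, b)` and `ℓᵃ⁺ᵇ⁺¹ ∣ det(1 − ρ γ)` for all `γ`; we find `Q`, `det Q ≠ 0`,
and `a' + b' = a + b + 1` with all `Q⁻¹ ρ(γ) Q` of shape `(a', b')` (`step`), and transport
(`exists_monoidHom_conj`). Write `ρ γ = 1 + D Y(γ)`, `D = diag(ℓᵃ, ℓᵇ)`; then
`Y(γδ) = Y(γ) + Y(δ) + Y(γ) D Y(δ)` and `det(1 − ρ γ) = ℓᵃ⁺ᵇ det Y(γ)`, so every `Ȳ(γ)`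
(reduction modulo `ℓ`) is singular.

* **I. Dichotomy** (`exists_common_mulVec_eq_zero_or_common_vecMul_eq_zero`): an ADDITIVE family
  of singular `2 × 2` matrices over a field has a common non-zero kernel vector or a common
  non-zero cokernel vector (polar form of `det`, rank-one propagation, and "a group is not the
  union of two proper subgroups", `forall_or_forall_of_forall_or'`).
* **II. Shape calculus** over `ℤ_ℓ` (`exists_eq_one_add_diagonal_mul_iff`,
  `det_one_sub_one_add_diagonal_mul`, transport `exists_monoidHom_conj`, coordinate swap
  `exists_conj_of_swap`).
* **III. The four moves** (`step_add_ker_generic/_special`, `step_add_im_generic/_special`): a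
  common kernel vector `(c̄, 1)` resp. `(1, 0)`, or cokernel vector `(−ē, 1)` resp. `(1, 0)`, of
  the `Ȳ(γ)` yields `Q = (ℓ c; 0 1)`, `diag(1, ℓ)`, `(1 0; ℓᵏ e 1)`, `1` and the new shape;
  `step_of_dichotomy` dispatches, and `step_add` is the case `1 ≤ a ≤ b` (there `ℓ ∣ D`, so `Ȳ`
  is additive and Part I applies).
* **IV. The Borel case `a = 0 < b`** (`borel_four_functions`, `step_borel`): `D̄ = diag(1, 0)`
  and the four residue functions `ā, b̄, c̄, d̄` obey twisted cocycle laws; an elementary analysis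
  (the character `1 + ā`, the subgroup `{ā = 0}`, commutator-like elements, and twice the
  two-subgroups lemma) produces one of the four kernel/cokernel conditions.
* **V. The base case `a = b = 0`** (`exists_common_fixed_or_cofixed`, `step_base`): `ρ̄` has a
  common fixed vector or a common fixed covector, via the invariant line of
  `Literature.RepresentationTheory.FiniteGroups.Representation.exists_finrank_eq_one_invariant_of_forall_exists_fixed`.
* **VI–VII.** `step` (with the swap for `a > b`) and the induction
  `katz_exists_lattice_of_det_one_sub_dvd`.

## References

* [Katz1980] N. M. Katz, *Galois properties of torsion points on abelian varieties*, Invent.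
  Math. 62 (1981) 481–502, Thm. 1 (and Lemma 1, p. 484).
* [CullinanKenneyVoight2022] J. Cullinan, M. Kenney, J. Voight, *On a probabilistic local-global
  principle for torsion on elliptic curves*, J. Théor. Nombres Bordeaux 34 (2022), Thm. 2.3.1,
  Lemma 2.3.5.
* arXiv:2602.21047 (2026), *Torsion points on `GL₂`-type abelian varieties*, Thm. 3.1 (the
  statement over a general local field).
-/

namespace Literature.NumberTheory.GaloisRepresentations

open Matrix

section Dichotomy

variable {k : Type*} [Field k]

/-- **A group is not the union of two proper subgroups**, predicate form: if every element
satisfies `A` or `B`, where `A (g₁ g₂) → A g₂ → A g₁` and `B (g₁ g₂) → B g₁ → B g₂`, then `A` holds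
everywhere or `B` does (file-local copy of
`Literature.NumberTheory.EllipticCurves.forall_or_forall_of_forall_or`, to keep this linear-algebra
file free of elliptic-curve imports). [folklore] -/
private theorem forall_or_forall_of_forall_or' {G : Type*} [Mul G] {A B : G → Prop}
    (h : ∀ g, A g ∨ B g) (hA : ∀ g₁ g₂, A (g₁ * g₂) → A g₂ → A g₁)
    (hB : ∀ g₁ g₂, B (g₁ * g₂) → B g₁ → B g₂) : (∀ g, A g) ∨ (∀ g, B g) := by
  by_contra hne
  push Not at hne
  obtain ⟨⟨g₁, hg₁⟩, ⟨g₂, hg₂⟩⟩ := hne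
  rcases h (g₁ * g₂) with h12 | h12
  · exact hg₁ (hA g₁ g₂ h12 ((h g₂).resolve_right hg₂))
  · exact hg₂ (hB g₁ g₂ h12 ((h g₁).resolve_left hg₁))

/-- The polar form of the determinant on `2 × 2` matrices:
`det(A + B) = det A + det B + (A₁₁B₀₀ − A₀₁B₁₀ − A₁₀B₀₁ + A₀₀B₁₁)`. [folklore] -/
theorem det_add_fin_two (A B : Matrix (Fin 2) (Fin 2) k) :
    (A + B).det = A.det + B.det +
      (A 1 1 * B 0 0 - A 0 1 * B 1 0 - A 1 0 * B 0 1 + A 0 0 * B 1 1) := by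
  simp only [Matrix.det_fin_two, Matrix.add_apply]
  ring

/-- **Kernel and cokernel vectors of a non-zero singular `2 × 2` matrix, adapted to the polar
form.** For `A ≠ 0` with `det A = 0` there are `x, w ∈ k² ∖ {0}` and `c ≠ 0` with `A x = 0`,
`wᵀ A = 0` and, for every `B`, `wᵀ B x = c · φ(A, B)` (`φ` the polar form of `det_add_fin_two`).
Explicitly, for `A = (p q; r s)`: `x = (s, −r)`, `w = (s, −q)`, `c = s` if `s ≠ 0`; `x = (q, −p)`,
`w = (r, −p)`, `c = p` if `p ≠ 0`; and `(q, 0), (0, −q), q` resp. `(0, −r), (r, 0), r` when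
`p = s = 0`. [folklore] -/
theorem exists_ker_coker_and_polar_eq {A : Matrix (Fin 2) (Fin 2) k} (hA : A ≠ 0)
    (hdet : A.det = 0) :
    ∃ (x w : Fin 2 → k) (c : k), x ≠ 0 ∧ w ≠ 0 ∧ c ≠ 0 ∧ A *ᵥ x = 0 ∧ w ᵥ* A = 0 ∧
      ∀ B : Matrix (Fin 2) (Fin 2) k,
        w ⬝ᵥ (B *ᵥ x) = c * (A 1 1 * B 0 0 - A 0 1 * B 1 0 - A 1 0 * B 0 1 + A 0 0 * B 1 1) := by
  rw [Matrix.det_fin_two] at hdet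
  have hne : ∀ v : Fin 2 → k, v ≠ 0 ↔ v 0 ≠ 0 ∨ v 1 ≠ 0 := fun v ↦ by
    constructor
    · intro hv
      by_contra h0
      push Not at h0
      exact hv (funext fun i ↦ by fin_cases i <;> simp [h0.1, h0.2])
    · rintro (h | h) h0 <;> exact h (by simp [h0])
  -- the three shapes of the computation, as one tactic block each
  have ev : ∀ (M : Matrix (Fin 2) (Fin 2) k) (a b : k),
      M *ᵥ ![a, b] = ![M 0 0 * a + M 0 1 * b, M 1 0 * a + M 1 1 * b] := fun M a b ↦ by
    ext i; fin_cases i <;> simp [Matrix.mulVec, dotProduct, Fin.sum_univ_two]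
  have evl : ∀ (M : Matrix (Fin 2) (Fin 2) k) (a b : k),
      ![a, b] ᵥ* M = ![a * M 0 0 + b * M 1 0, a * M 0 1 + b * M 1 1] := fun M a b ↦ by
    ext j; fin_cases j <;> simp [Matrix.vecMul, dotProduct, Fin.sum_univ_two]
  have dot : ∀ a b c d : k, ![a, b] ⬝ᵥ ![c, d] = a * c + b * d := fun a b c d ↦ by
    simp [dotProduct, Fin.sum_univ_two]
  have vec0 : ∀ a b : k, (![a, b] = 0) ↔ a = 0 ∧ b = 0 := fun a b ↦ by
    constructor
    · intro h
      exact ⟨by simpa using congrFun h 0, by simpa using congrFun h 1⟩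
    · rintro ⟨rfl, rfl⟩
      ext i; fin_cases i <;> simp
  by_cases hs : A 1 1 ≠ 0
  · refine ⟨![A 1 1, -A 1 0], ![A 1 1, -A 0 1], A 1 1, (hne _).mpr (Or.inl (by simpa using hs)),
      (hne _).mpr (Or.inl (by simpa using hs)), hs, ?_, ?_, fun B ↦ ?_⟩
    · rw [ev, vec0]; constructor
      · linear_combination hdet
      · ring
    · rw [evl, vec0]; constructor
      · linear_combination hdet
      · ring
    · rw [ev, dot]
      linear_combination (-(B 1 1)) * hdet
  push Not at hs
  by_cases hp : A 0 0 ≠ 0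
  · refine ⟨![A 0 1, -A 0 0], ![A 1 0, -A 0 0], A 0 0, (hne _).mpr (Or.inr (by simpa using hp)),
      (hne _).mpr (Or.inr (by simpa using hp)), hp, ?_, ?_, fun B ↦ ?_⟩
    · rw [ev, vec0]; constructor
      · ring
      · linear_combination (-1 : k) * hdet
    · rw [evl, vec0]; constructor
      · ring
      · linear_combination (-1 : k) * hdet
    · rw [ev, dot]
      linear_combination (-(B 0 0)) * hdet
  push Not at hp
  -- `p = s = 0`, so `q r = 0`; `A ≠ 0` forces `q ≠ 0` or `r ≠ 0`
  have hqr : A 0 1 * A 1 0 = 0 := by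
    have : A 0 0 * A 1 1 - A 0 1 * A 1 0 = 0 := hdet
    rw [hp, hs, zero_mul, zero_sub, neg_eq_zero] at this
    exact this
  by_cases hq : A 0 1 ≠ 0
  · have hr : A 1 0 = 0 := (mul_eq_zero.mp hqr).resolve_left hq
    refine ⟨![A 0 1, 0], ![0, -A 0 1], A 0 1, (hne _).mpr (Or.inl (by simpa using hq)),
      (hne _).mpr (Or.inr (by simpa using hq)), hq, ?_, ?_, fun B ↦ ?_⟩
    · rw [ev, vec0, hp, hr]; constructor <;> ring
    · rw [evl, vec0, hs, hr]; constructor <;> ring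
    · rw [ev, dot, hp, hs, hr]
      ring
  push Not at hq
  have hr : A 1 0 ≠ 0 := by
    intro hr
    exact hA (by ext i j; fin_cases i <;> fin_cases j <;> simp [hp, hq, hr, hs])
  refine ⟨![0, -A 1 0], ![A 1 0, 0], A 1 0, (hne _).mpr (Or.inr (by simpa using hr)),
    (hne _).mpr (Or.inl (by simpa using hr)), hr, ?_, ?_, fun B ↦ ?_⟩
  · rw [ev, vec0, hq, hs]; constructor <;> ring
  · rw [evl, vec0, hp, hq]; constructor <;> ring
  · rw [ev, dot, hp, hq, hs]
    ring

/-- **Rank-one propagation.** For a singular `2 × 2` matrix `B` over a field, a vector `x` with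
`B x ≠ 0` and `w` with `wᵀ (B x) = 0`: `wᵀ (B y) = 0` for every `y` — the image of `B` is the line
through `B x` (any two vectors `B x`, `B y` have `det [B x, B y] = det B · det [x, y] = 0`).
[folklore] -/
theorem dotProduct_mulVec_eq_zero_of_rank_le_one {B : Matrix (Fin 2) (Fin 2) k} (hB : B.det = 0)
    {x w : Fin 2 → k} (hx : B *ᵥ x ≠ 0) (hw : w ⬝ᵥ (B *ᵥ x) = 0) (y : Fin 2 → k) :
    w ⬝ᵥ (B *ᵥ y) = 0 := by
  set u := B *ᵥ x with hu
  set u' := B *ᵥ y with hu'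
  have hdet : u 0 * u' 1 - u 1 * u' 0 = B.det * (x 0 * y 1 - x 1 * y 0) := by
    simp only [hu, hu', Matrix.mulVec, dotProduct, Fin.sum_univ_two, Matrix.det_fin_two]
    ring
  rw [hB, zero_mul] at hdet
  have hw' : w 0 * u 0 + w 1 * u 1 = 0 := by
    simpa [dotProduct, Fin.sum_univ_two] using hw
  show w ⬝ᵥ u' = 0
  rw [dotProduct, Fin.sum_univ_two]
  by_cases h0 : u 0 = 0
  · have h1 : u 1 ≠ 0 := by
      intro h1
      exact hx (funext fun i ↦ by fin_cases i <;> simp [h0, h1])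
    have hu'0 : u' 0 = 0 := by
      rw [h0, zero_mul, zero_sub, neg_eq_zero] at hdet
      exact (mul_eq_zero.mp hdet).resolve_left h1
    have hw1 : w 1 = 0 := by
      rw [h0, mul_zero, zero_add] at hw'
      exact (mul_eq_zero.mp hw').resolve_right h1
    rw [hu'0, hw1, mul_zero, zero_mul, add_zero]
  · -- `u' = (u'₀/u₀) u`
    have key : u 0 * (w 0 * u' 0 + w 1 * u' 1) = u' 0 * (w 0 * u 0 + w 1 * u 1) := by
      linear_combination (w 1) * hdet
    rw [hw', mul_zero] at key
    exact (mul_eq_zero.mp key).resolve_left h0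

/-- **An additive family of singular `2 × 2` matrices over a field has a common non-zero kernel
vector or a common non-zero cokernel vector** (the linear-algebra dichotomy in the inductive
step of Katz 1981, Thm. 1; cf. Lemma 1, p. 484, and Cullinan–Kenney–Voight 2022, Lemma 2.3.5 for
the multiplicative analogue at `n = 1`). Here `Γ` is a group and `Y : Γ → M₂(k)` satisfies
`Y(gh) = Y(g) + Y(h)` with `det Y(g) = 0` for all `g`. [cite: Katz1980, Thm. 1 (proof)] [cite: CullinanKenneyVoight2022, Lemma 2.3.5] -/
theorem exists_common_mulVec_eq_zero_or_common_vecMul_eq_zero {Γ : Type*} [Group Γ]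
    (Y : Γ → Matrix (Fin 2) (Fin 2) k) (hmul : ∀ g h, Y (g * h) = Y g + Y h)
    (hdet : ∀ g, (Y g).det = 0) :
    (∃ x : Fin 2 → k, x ≠ 0 ∧ ∀ g, Y g *ᵥ x = 0) ∨
      (∃ w : Fin 2 → k, w ≠ 0 ∧ ∀ g, w ᵥ* Y g = 0) := by
  classical
  by_cases hall : ∀ g, Y g = 0
  · left
    refine ⟨![1, 0], by simp, fun g ↦ by rw [hall g, Matrix.zero_mulVec]⟩
  push Not at hall
  obtain ⟨g₀, hg₀⟩ := hall
  obtain ⟨x, w, c, hx, hw, hc, hAx, hwA, hpolar⟩ := exists_ker_coker_and_polar_eq hg₀ (hdet g₀)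
  -- every `B = Y g` has `wᵀ B x = 0`
  have hwBx : ∀ g, w ⬝ᵥ (Y g *ᵥ x) = 0 := by
    intro g
    have h1 := det_add_fin_two (Y g₀) (Y g)
    rw [← hmul, hdet, hdet, hdet, zero_add, zero_add] at h1
    rw [hpolar, ← h1, mul_zero]
  -- hence `B x = 0` or `wᵀ B = 0`
  have hdich : ∀ g, Y g *ᵥ x = 0 ∨ w ᵥ* Y g = 0 := by
    intro g
    by_cases hBx : Y g *ᵥ x = 0
    · exact Or.inl hBx
    · right
      have hall : ∀ y, (w ᵥ* Y g) ⬝ᵥ y = 0 := fun y ↦ by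
        rw [← Matrix.dotProduct_mulVec]
        exact dotProduct_mulVec_eq_zero_of_rank_le_one (hdet g) hBx (hwBx g) y
      funext j
      simpa using hall (Pi.single j 1)
  -- both conditions are subgroups; a group is not a union of two proper subgroups
  have hA : ∀ g₁ g₂ : Γ, Y (g₁ * g₂) *ᵥ x = 0 → Y g₂ *ᵥ x = 0 → Y g₁ *ᵥ x = 0 := by
    intro g₁ g₂ h12 h2
    rwa [hmul, Matrix.add_mulVec, h2, add_zero] at h12
  have hB : ∀ g₁ g₂ : Γ, w ᵥ* Y (g₁ * g₂) = 0 → w ᵥ* Y g₁ = 0 → w ᵥ* Y g₂ = 0 := by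
    intro g₁ g₂ h12 h1
    rwa [hmul, Matrix.vecMul_add, h1, zero_add] at h12
  rcases forall_or_forall_of_forall_or' hdich hA hB with h | h
  · exact Or.inl ⟨x, hx, h⟩
  · exact Or.inr ⟨w, hw, h⟩

end Dichotomy

/-! ## II. The shape calculus over `ℤ_ℓ`

`Shape a b X` (written out, no definition): `ℓᵃ ∣ X₀₀ − 1`, `ℓᵃ ∣ X₀₁`, `ℓᵇ ∣ X₁₀`, `ℓᵇ ∣ X₁₁ − 1`,
i.e. `X = 1 + diag(ℓᵃ, ℓᵇ) Y` — membership in Katz's group `G(n; a, b)`, `n = a + b`. The data of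
the induction are a homomorphism `ρ : Γ →* M₂(ℤ_ℓ)`, an integral matrix `P` with `det P ≠ 0`
(the columns span the current lattice) and, for every `γ`, a matrix `X` of shape `(a, b)` with
`ρ γ · P = P · X`. -/

section Padic

variable {ℓ : ℕ} [hℓ : Fact ℓ.Prime]

open PadicInt

/-- `ℓ ∣ x` in `ℤ_ℓ` iff `x ≡ 0 (mod ℓ)`. [folklore] -/
theorem toZMod_eq_zero_iff_dvd (x : ℤ_[ℓ]) : toZMod x = 0 ↔ (ℓ : ℤ_[ℓ]) ∣ x := by
  rw [← RingHom.mem_ker, ker_toZMod, maximalIdeal_eq_span_p, Ideal.mem_span_singleton]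

/-- A lift of a residue: `toZMod (c.val) = c`. [folklore] -/
theorem toZMod_natCast_val (c : ZMod ℓ) : toZMod ((c.val : ℕ) : ℤ_[ℓ]) = c := by
  rw [map_natCast, ZMod.natCast_zmod_val]

/-- An element of `ℤ_ℓ` with non-zero residue is a unit. [folklore] -/
theorem isUnit_of_toZMod_ne_zero {x : ℤ_[ℓ]} (hx : toZMod x ≠ 0) : IsUnit x := by
  rw [isUnit_iff]
  rcases (norm_le_one x).lt_or_eq with h | h
  · exact absurd ((toZMod_eq_zero_iff_dvd x).mpr ((norm_lt_one_iff_dvd x).mp h)) hx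
  · exact h

variable {Γ : Type*} [Group Γ]

/-- `diag(ℓᵃ, ℓᵇ)` is left-cancellable on `M₂(ℤ_ℓ)`. [folklore] -/
theorem diagonal_pow_mul_injective (a b : ℕ) {Y Y' : Matrix (Fin 2) (Fin 2) ℤ_[ℓ]}
    (h : Matrix.diagonal ![(ℓ : ℤ_[ℓ]) ^ a, (ℓ : ℤ_[ℓ]) ^ b] * Y =
      Matrix.diagonal ![(ℓ : ℤ_[ℓ]) ^ a, (ℓ : ℤ_[ℓ]) ^ b] * Y') : Y = Y' := by
  have hl : (ℓ : ℤ_[ℓ]) ≠ 0 := Nat.cast_ne_zero.mpr hℓ.out.ne_zero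
  ext i j
  have hij := congrFun (congrFun h i) j
  rw [Matrix.diagonal_mul, Matrix.diagonal_mul] at hij
  fin_cases i
  · exact mul_left_cancel₀ (pow_ne_zero a hl) (by simpa using hij)
  · exact mul_left_cancel₀ (pow_ne_zero b hl) (by simpa using hij)

/-- **Shape as entrywise divisibility.** `X = 1 + diag(ℓᵃ, ℓᵇ) Y` for some `Y` iff
`ℓᵃ ∣ X₀₀ − 1`, `ℓᵃ ∣ X₀₁`, `ℓᵇ ∣ X₁₀`, `ℓᵇ ∣ X₁₁ − 1`. [folklore] -/
theorem exists_eq_one_add_diagonal_mul_iff (a b : ℕ) (X : Matrix (Fin 2) (Fin 2) ℤ_[ℓ]) :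
    (∃ Y : Matrix (Fin 2) (Fin 2) ℤ_[ℓ],
        X = 1 + Matrix.diagonal ![(ℓ : ℤ_[ℓ]) ^ a, (ℓ : ℤ_[ℓ]) ^ b] * Y) ↔
      (ℓ : ℤ_[ℓ]) ^ a ∣ X 0 0 - 1 ∧ (ℓ : ℤ_[ℓ]) ^ a ∣ X 0 1 ∧ (ℓ : ℤ_[ℓ]) ^ b ∣ X 1 0 ∧
        (ℓ : ℤ_[ℓ]) ^ b ∣ X 1 1 - 1 := by
  constructor
  · rintro ⟨Y, rfl⟩
    simp [Matrix.add_apply, Matrix.diagonal_mul]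
  · rintro ⟨⟨y00, h00⟩, ⟨y01, h01⟩, ⟨y10, h10⟩, ⟨y11, h11⟩⟩
    refine ⟨!![y00, y01; y10, y11], ?_⟩
    ext i j
    fin_cases i <;> fin_cases j
    · simp [Matrix.add_apply, Matrix.diagonal_mul]
      linear_combination h00
    · simp [Matrix.add_apply, Matrix.diagonal_mul]
      linear_combination h01
    · simp [Matrix.add_apply, Matrix.diagonal_mul]
      linear_combination h10
    · simp [Matrix.add_apply, Matrix.diagonal_mul]
      linear_combination h11

/-- The determinant congruence for a matrix of shape `(a, b)`:
`det(1 − (1 + D Y)) = ℓᵃ⁺ᵇ det Y`. [folklore] -/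
theorem det_one_sub_one_add_diagonal_mul (a b : ℕ) (Y : Matrix (Fin 2) (Fin 2) ℤ_[ℓ]) :
    (1 - (1 + Matrix.diagonal ![(ℓ : ℤ_[ℓ]) ^ a, (ℓ : ℤ_[ℓ]) ^ b] * Y)).det =
      (ℓ : ℤ_[ℓ]) ^ (a + b) * Y.det := by
  rw [show (1 : Matrix (Fin 2) (Fin 2) ℤ_[ℓ]) -
      (1 + Matrix.diagonal ![(ℓ : ℤ_[ℓ]) ^ a, (ℓ : ℤ_[ℓ]) ^ b] * Y) =
      -(Matrix.diagonal ![(ℓ : ℤ_[ℓ]) ^ a, (ℓ : ℤ_[ℓ]) ^ b] * Y) by abel,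
    Matrix.det_neg, Matrix.det_mul, Matrix.det_diagonal]
  simp [Fin.prod_univ_two, pow_add]

/-- **Transport along `P`.** If `det P ≠ 0` and every `ρ γ · P = P · X_γ` for some `X_γ`, then
`γ ↦ X_γ` is well defined and multiplicative: a homomorphism `ρ' : Γ →* M₂(ℤ_ℓ)` with
`ρ γ · P = P · ρ' γ`, `det(1 − ρ' γ) = det(1 − ρ γ)`, and `ρ' γ = X` whenever `ρ γ · P = P · X`
(the representation on the lattice spanned by the columns of `P`). [folklore] -/
theorem exists_monoidHom_conj {ρ : Γ →* Matrix (Fin 2) (Fin 2) ℤ_[ℓ]}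
    {P : Matrix (Fin 2) (Fin 2) ℤ_[ℓ]} (hP : P.det ≠ 0)
    (h : ∀ γ, ∃ X : Matrix (Fin 2) (Fin 2) ℤ_[ℓ], ρ γ * P = P * X) :
    ∃ ρ' : Γ →* Matrix (Fin 2) (Fin 2) ℤ_[ℓ],
      (∀ γ, ρ γ * P = P * ρ' γ) ∧ (∀ γ, (1 - ρ' γ).det = (1 - ρ γ).det) ∧
        ∀ γ X, ρ γ * P = P * X → ρ' γ = X := by
  classical
  -- `P` is left-cancellable
  have hcancel : ∀ X X' : Matrix (Fin 2) (Fin 2) ℤ_[ℓ], P * X = P * X' → X = X' := by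
    intro X X' hXX
    have h1 : P.adjugate * (P * X) = P.adjugate * (P * X') := by rw [hXX]
    rw [← Matrix.mul_assoc, ← Matrix.mul_assoc, Matrix.adjugate_mul, Matrix.smul_mul,
      Matrix.smul_mul, Matrix.one_mul, Matrix.one_mul] at h1
    ext i j
    have hij := congrFun (congrFun h1 i) j
    simp only [Matrix.smul_apply, smul_eq_mul] at hij
    exact mul_left_cancel₀ hP hij
  choose X hX using h
  have hmul : ∀ γ δ, X (γ * δ) = X γ * X δ := fun γ δ ↦ hcancel _ _ (by
    rw [← hX (γ * δ), map_mul, Matrix.mul_assoc, hX δ, ← Matrix.mul_assoc, hX γ,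
      Matrix.mul_assoc])
  have hone : X 1 = 1 := hcancel _ _ (by rw [← hX 1, map_one, Matrix.one_mul, Matrix.mul_one])
  let ρ' : Γ →* Matrix (Fin 2) (Fin 2) ℤ_[ℓ] :=
    { toFun := X, map_one' := hone, map_mul' := hmul }
  have hρ' : ∀ γ, ρ' γ = X γ := fun γ ↦ rfl
  refine ⟨ρ', fun γ ↦ (hρ' γ).symm ▸ hX γ, fun γ ↦ ?_,
    fun γ X' hX' ↦ (hρ' γ).trans (hcancel _ _ ((hX γ).symm.trans hX'))⟩
  -- `(1 − ρ γ) P = P (1 − X γ)`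
  rw [hρ']
  have h1 : (1 - ρ γ) * P = P * (1 - X γ) := by
    rw [Matrix.sub_mul, Matrix.mul_sub, Matrix.one_mul, Matrix.mul_one, hX γ]
  have h2 : (1 - ρ γ).det * P.det = (1 - X γ).det * P.det := by
    have h3 := congrArg Matrix.det h1
    rwa [Matrix.det_mul, Matrix.det_mul, mul_comm P.det] at h3
  exact (mul_right_cancel₀ hP h2).symm

/-- **Swapping the coordinates.** Conjugation by `S = (0 1; 1 0)` turns a homomorphism of shape
`(a, b)` into one of shape `(b, a)`; a conjugating matrix `Q` for the swapped homomorphism gives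
the conjugating matrix `S Q` for the original one, with the same target shape. [folklore] -/
theorem exists_conj_of_swap {ρ : Γ →* Matrix (Fin 2) (Fin 2) ℤ_[ℓ]} {a b : ℕ}
    (hshape : ∀ γ, (ℓ : ℤ_[ℓ]) ^ a ∣ ρ γ 0 0 - 1 ∧ (ℓ : ℤ_[ℓ]) ^ a ∣ ρ γ 0 1 ∧
      (ℓ : ℤ_[ℓ]) ^ b ∣ ρ γ 1 0 ∧ (ℓ : ℤ_[ℓ]) ^ b ∣ ρ γ 1 1 - 1)
    (hstep : ∀ ρ' : Γ →* Matrix (Fin 2) (Fin 2) ℤ_[ℓ],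
      (∀ γ, (ℓ : ℤ_[ℓ]) ^ b ∣ ρ' γ 0 0 - 1 ∧ (ℓ : ℤ_[ℓ]) ^ b ∣ ρ' γ 0 1 ∧
        (ℓ : ℤ_[ℓ]) ^ a ∣ ρ' γ 1 0 ∧ (ℓ : ℤ_[ℓ]) ^ a ∣ ρ' γ 1 1 - 1) →
      (∀ γ, (1 - ρ' γ).det = (1 - ρ γ).det) →
      ∃ (Q : Matrix (Fin 2) (Fin 2) ℤ_[ℓ]) (a' b' : ℕ), Q.det ≠ 0 ∧ a' + b' = a + b + 1 ∧
        ∀ γ, ∃ X : Matrix (Fin 2) (Fin 2) ℤ_[ℓ], ρ' γ * Q = Q * X ∧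
          ((ℓ : ℤ_[ℓ]) ^ a' ∣ X 0 0 - 1 ∧ (ℓ : ℤ_[ℓ]) ^ a' ∣ X 0 1 ∧
            (ℓ : ℤ_[ℓ]) ^ b' ∣ X 1 0 ∧ (ℓ : ℤ_[ℓ]) ^ b' ∣ X 1 1 - 1)) :
    ∃ (Q : Matrix (Fin 2) (Fin 2) ℤ_[ℓ]) (a' b' : ℕ), Q.det ≠ 0 ∧ a' + b' = a + b + 1 ∧
      ∀ γ, ∃ X : Matrix (Fin 2) (Fin 2) ℤ_[ℓ], ρ γ * Q = Q * X ∧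
        ((ℓ : ℤ_[ℓ]) ^ a' ∣ X 0 0 - 1 ∧ (ℓ : ℤ_[ℓ]) ^ a' ∣ X 0 1 ∧
          (ℓ : ℤ_[ℓ]) ^ b' ∣ X 1 0 ∧ (ℓ : ℤ_[ℓ]) ^ b' ∣ X 1 1 - 1) := by
  set S : Matrix (Fin 2) (Fin 2) ℤ_[ℓ] := !![0, 1; 1, 0] with hS
  have hSS : S * S = 1 := by
    ext i j; fin_cases i <;> fin_cases j <;> simp [hS, Matrix.mul_apply, Fin.sum_univ_two]
  have hSc : ∀ M : Matrix (Fin 2) (Fin 2) ℤ_[ℓ], S * M * S = !![M 1 1, M 1 0; M 0 1, M 0 0] := by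
    intro M
    ext i j; fin_cases i <;> fin_cases j <;>
      simp [hS, Matrix.mul_apply, Fin.sum_univ_two, Matrix.vecMul, dotProduct]
  let ρs : Γ →* Matrix (Fin 2) (Fin 2) ℤ_[ℓ] :=
    { toFun := fun γ ↦ S * ρ γ * S
      map_one' := by rw [map_one, Matrix.mul_one, hSS]
      map_mul' := fun γ δ ↦ by
        rw [map_mul]
        calc S * (ρ γ * ρ δ) * S = S * (ρ γ * (S * S) * ρ δ) * S := by
              rw [hSS, Matrix.mul_one]
          _ = S * ρ γ * S * (S * ρ δ * S) := by
              simp only [Matrix.mul_assoc] }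
  have hρs : ∀ γ, ρs γ = !![ρ γ 1 1, ρ γ 1 0; ρ γ 0 1, ρ γ 0 0] := fun γ ↦ hSc (ρ γ)
  obtain ⟨Q, a', b', hQ, hab, hX⟩ := hstep ρs (fun γ ↦ by
      obtain ⟨h00, h01, h10, h11⟩ := hshape γ
      rw [hρs]; simp; exact ⟨h11, h10, h01, h00⟩)
    (fun γ ↦ by
      rw [hρs]
      simp [Matrix.det_fin_two]
      ring)
  refine ⟨S * Q, a', b', ?_, hab, fun γ ↦ ?_⟩
  · rw [Matrix.det_mul]
    have hdS : S.det = -1 := by simp [hS, Matrix.det_fin_two]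
    rw [hdS]
    simpa using hQ
  · obtain ⟨X, hXe, hXs⟩ := hX γ
    refine ⟨X, ?_, hXs⟩
    have h1 : ρs γ = S * ρ γ * S := rfl
    calc ρ γ * (S * Q) = S * S * ρ γ * S * Q := by rw [hSS, Matrix.one_mul, Matrix.mul_assoc]
      _ = S * (ρs γ * Q) := by simp only [h1, Matrix.mul_assoc]
      _ = S * (Q * X) := by rw [hXe]
      _ = S * Q * X := by rw [Matrix.mul_assoc]

end Padic

/-! ## III. The inductive step for shapes `(a, b)` with `1 ≤ a ≤ b`: the additive case

Write `ρ γ = 1 + D Y(γ)`, `D = diag(ℓᵃ, ℓᵇ)`, `b = a + k`. Since `ℓ ∣ D`, the map `γ ↦ Ȳ(γ)`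
(`Y` mod `ℓ`) is additive, and `det(1 − ρ γ) = ℓᵃ⁺ᵇ det Y(γ) ≡ 0 (mod ℓᵃ⁺ᵇ⁺¹)` makes every `Ȳ(γ)`
singular; by Part I there is a common kernel vector or a common cokernel vector, normalised to
`(c̄, 1)` / `(1, 0)`, resp. `(−ē, 1)` / `(1, 0)`. The four lattice moves (conjugating matrices
`Q`, new shapes): kernel `(c̄, 1)`: `Q = (ℓ c; 0 1)`, shape `(a, b + 1)`; kernel `(1, 0)`:
`Q = diag(1, ℓ)`, shape `(a + 1, b)`; cokernel `(−ē, 1)` (row `1 ≡ e ·` row `0`):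
`Q = (1 0; ℓᵏ e 1)`, shape `(a, b + 1)`; cokernel `(1, 0)` (row `0 ≡ 0`): `Q = 1`, shape
`(a + 1, b)`. -/

section StepAdd

variable {ℓ : ℕ} [hℓ : Fact ℓ.Prime] {Γ : Type*} [Group Γ]

open PadicInt

/-- Kernel vector `(c̄, 1)`: conjugate by `Q = (ℓ c; 0 1)`; new shape `(a, b + 1)`. [cite: Katz1980, Thm. 1 (proof)] -/
theorem step_add_ker_generic {ρ : Γ →* Matrix (Fin 2) (Fin 2) ℤ_[ℓ]} {a k : ℕ}
    {Y : Γ → Matrix (Fin 2) (Fin 2) ℤ_[ℓ]}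
    (hY : ∀ γ, ρ γ = 1 + Matrix.diagonal ![(ℓ : ℤ_[ℓ]) ^ a, (ℓ : ℤ_[ℓ]) ^ (a + k)] * Y γ)
    (c : ℤ_[ℓ])
    (hc : ∀ γ, (ℓ : ℤ_[ℓ]) ∣ c * Y γ 0 0 + Y γ 0 1 ∧ (ℓ : ℤ_[ℓ]) ∣ c * Y γ 1 0 + Y γ 1 1) :
    ∃ (Q : Matrix (Fin 2) (Fin 2) ℤ_[ℓ]) (a' b' : ℕ), Q.det ≠ 0 ∧ a' + b' = a + (a + k) + 1 ∧
      ∀ γ, ∃ X : Matrix (Fin 2) (Fin 2) ℤ_[ℓ], ρ γ * Q = Q * X ∧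
        ((ℓ : ℤ_[ℓ]) ^ a' ∣ X 0 0 - 1 ∧ (ℓ : ℤ_[ℓ]) ^ a' ∣ X 0 1 ∧
          (ℓ : ℤ_[ℓ]) ^ b' ∣ X 1 0 ∧ (ℓ : ℤ_[ℓ]) ^ b' ∣ X 1 1 - 1) := by
  have hl : (ℓ : ℤ_[ℓ]) ≠ 0 := Nat.cast_ne_zero.mpr hℓ.out.ne_zero
  refine ⟨!![(ℓ : ℤ_[ℓ]), c; 0, 1], a, a + k + 1, by simp [Matrix.det_fin_two, hl], by ring,
    fun γ ↦ ?_⟩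
  obtain ⟨⟨z₀, hz₀⟩, ⟨z₁, hz₁⟩⟩ := hc γ
  set L : ℤ_[ℓ] := (ℓ : ℤ_[ℓ]) with hL
  refine ⟨!![1 + L ^ a * Y γ 0 0 - c * (L ^ (a + k) * Y γ 1 0), L ^ a * z₀ - c * L ^ (a + k) * z₁;
      L * (L ^ (a + k) * Y γ 1 0), 1 + L ^ (a + k) * Y γ 1 1 + c * (L ^ (a + k) * Y γ 1 0)],
    ?_, ?_, ?_, ?_, ?_⟩
  · rw [hY γ]
    ext i j
    fin_cases i <;> fin_cases j <;>
      simp [Matrix.mul_apply, Matrix.add_apply, Fin.sum_univ_two, Matrix.one_apply] <;>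
      first | ring1 | linear_combination L ^ a * hz₀ - c * L ^ (a + k) * hz₁
  · exact ⟨Y γ 0 0 - c * L ^ k * Y γ 1 0, by simp; ring⟩
  · exact ⟨z₀ - c * L ^ k * z₁, by simp; ring⟩
  · exact ⟨Y γ 1 0, by simp; ring⟩
  · exact ⟨z₁, by simp; linear_combination L ^ (a + k) * hz₁⟩

/-- Kernel vector `(1, 0)`: conjugate by `Q = diag(1, ℓ)`; new shape `(a + 1, b)`. [cite: Katz1980, Thm. 1 (proof)] -/
theorem step_add_ker_special {ρ : Γ →* Matrix (Fin 2) (Fin 2) ℤ_[ℓ]} {a k : ℕ}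
    {Y : Γ → Matrix (Fin 2) (Fin 2) ℤ_[ℓ]}
    (hY : ∀ γ, ρ γ = 1 + Matrix.diagonal ![(ℓ : ℤ_[ℓ]) ^ a, (ℓ : ℤ_[ℓ]) ^ (a + k)] * Y γ)
    (hc : ∀ γ, (ℓ : ℤ_[ℓ]) ∣ Y γ 0 0 ∧ (ℓ : ℤ_[ℓ]) ∣ Y γ 1 0) :
    ∃ (Q : Matrix (Fin 2) (Fin 2) ℤ_[ℓ]) (a' b' : ℕ), Q.det ≠ 0 ∧ a' + b' = a + (a + k) + 1 ∧
      ∀ γ, ∃ X : Matrix (Fin 2) (Fin 2) ℤ_[ℓ], ρ γ * Q = Q * X ∧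
        ((ℓ : ℤ_[ℓ]) ^ a' ∣ X 0 0 - 1 ∧ (ℓ : ℤ_[ℓ]) ^ a' ∣ X 0 1 ∧
          (ℓ : ℤ_[ℓ]) ^ b' ∣ X 1 0 ∧ (ℓ : ℤ_[ℓ]) ^ b' ∣ X 1 1 - 1) := by
  have hl : (ℓ : ℤ_[ℓ]) ≠ 0 := Nat.cast_ne_zero.mpr hℓ.out.ne_zero
  refine ⟨!![1, 0; 0, (ℓ : ℤ_[ℓ])], a + 1, a + k, by simp [Matrix.det_fin_two, hl], by ring,
    fun γ ↦ ?_⟩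
  obtain ⟨⟨z₀, hz₀⟩, ⟨z₁, hz₁⟩⟩ := hc γ
  set L : ℤ_[ℓ] := (ℓ : ℤ_[ℓ]) with hL
  refine ⟨!![1 + L ^ a * Y γ 0 0, L * (L ^ a * Y γ 0 1); L ^ (a + k) * z₁, 1 + L ^ (a + k) * Y γ 1 1],
    ?_, ?_, ?_, ?_, ?_⟩
  · rw [hY γ]
    ext i j
    fin_cases i <;> fin_cases j <;>
      simp [Matrix.mul_apply, Matrix.add_apply, Fin.sum_univ_two, Matrix.one_apply] <;>
      first | ring1 | linear_combination L ^ (a + k) * hz₁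
  · exact ⟨z₀, by simp; rw [hz₀]; ring⟩
  · exact ⟨Y γ 0 1, by simp; ring⟩
  · exact ⟨z₁, by simp⟩
  · exact ⟨Y γ 1 1, by simp⟩

/-- Cokernel vector `(−ē, 1)`, i.e. row `1` of `Ȳ` is `ē ·` row `0`: conjugate by
`Q = (1 0; ℓᵏ e 1)`; new shape `(a, b + 1)`. [cite: Katz1980, Thm. 1 (proof)] -/
theorem step_add_im_generic {ρ : Γ →* Matrix (Fin 2) (Fin 2) ℤ_[ℓ]} {a k : ℕ}
    {Y : Γ → Matrix (Fin 2) (Fin 2) ℤ_[ℓ]}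
    (hY : ∀ γ, ρ γ = 1 + Matrix.diagonal ![(ℓ : ℤ_[ℓ]) ^ a, (ℓ : ℤ_[ℓ]) ^ (a + k)] * Y γ)
    (e : ℤ_[ℓ])
    (he : ∀ γ, (ℓ : ℤ_[ℓ]) ∣ Y γ 1 0 - e * Y γ 0 0 ∧ (ℓ : ℤ_[ℓ]) ∣ Y γ 1 1 - e * Y γ 0 1) :
    ∃ (Q : Matrix (Fin 2) (Fin 2) ℤ_[ℓ]) (a' b' : ℕ), Q.det ≠ 0 ∧ a' + b' = a + (a + k) + 1 ∧
      ∀ γ, ∃ X : Matrix (Fin 2) (Fin 2) ℤ_[ℓ], ρ γ * Q = Q * X ∧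
        ((ℓ : ℤ_[ℓ]) ^ a' ∣ X 0 0 - 1 ∧ (ℓ : ℤ_[ℓ]) ^ a' ∣ X 0 1 ∧
          (ℓ : ℤ_[ℓ]) ^ b' ∣ X 1 0 ∧ (ℓ : ℤ_[ℓ]) ^ b' ∣ X 1 1 - 1) := by
  refine ⟨!![1, 0; (ℓ : ℤ_[ℓ]) ^ k * e, 1], a, a + k + 1, by simp [Matrix.det_fin_two], by ring,
    fun γ ↦ ?_⟩
  obtain ⟨⟨z₀, hz₀⟩, ⟨z₁, hz₁⟩⟩ := he γ
  set L : ℤ_[ℓ] := (ℓ : ℤ_[ℓ]) with hL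
  set μ : ℤ_[ℓ] := L ^ k * e with hμ
  -- `X = Q⁻¹ (1 + D Y) Q`
  refine ⟨!![1 + L ^ a * Y γ 0 0 + μ * (L ^ a * Y γ 0 1), L ^ a * Y γ 0 1;
      L ^ (a + k) * Y γ 1 0 + μ * (1 + L ^ (a + k) * Y γ 1 1) - μ * (1 + L ^ a * Y γ 0 0) -
        μ * μ * (L ^ a * Y γ 0 1),
      1 + L ^ (a + k) * Y γ 1 1 - μ * (L ^ a * Y γ 0 1)], ?_, ?_, ?_, ?_, ?_⟩
  · rw [hY γ]
    ext i j
    fin_cases i <;> fin_cases j <;>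
      simp [Matrix.mul_apply, Matrix.add_apply, Fin.sum_univ_two, Matrix.one_apply] <;> ring
  · exact ⟨Y γ 0 0 + μ * Y γ 0 1, by simp; ring⟩
  · exact ⟨Y γ 0 1, by simp⟩
  · refine ⟨z₀ + L ^ k * e * z₁, ?_⟩
    simp only [Matrix.of_apply, Matrix.cons_val_zero, Matrix.cons_val_one]
    rw [hμ]
    linear_combination L ^ (a + k) * hz₀ + L ^ (a + k) * L ^ k * e * hz₁
  · refine ⟨z₁, ?_⟩
    simp only [Matrix.of_apply, Matrix.cons_val_zero, Matrix.cons_val_one]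
    rw [hμ]
    linear_combination L ^ (a + k) * hz₁

/-- Cokernel vector `(1, 0)`, i.e. row `0` of `Ȳ` vanishes: `Q = 1`; new shape `(a + 1, b)`. [cite: Katz1980, Thm. 1 (proof)] -/
theorem step_add_im_special {ρ : Γ →* Matrix (Fin 2) (Fin 2) ℤ_[ℓ]} {a k : ℕ}
    {Y : Γ → Matrix (Fin 2) (Fin 2) ℤ_[ℓ]}
    (hY : ∀ γ, ρ γ = 1 + Matrix.diagonal ![(ℓ : ℤ_[ℓ]) ^ a, (ℓ : ℤ_[ℓ]) ^ (a + k)] * Y γ)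
    (he : ∀ γ, (ℓ : ℤ_[ℓ]) ∣ Y γ 0 0 ∧ (ℓ : ℤ_[ℓ]) ∣ Y γ 0 1) :
    ∃ (Q : Matrix (Fin 2) (Fin 2) ℤ_[ℓ]) (a' b' : ℕ), Q.det ≠ 0 ∧ a' + b' = a + (a + k) + 1 ∧
      ∀ γ, ∃ X : Matrix (Fin 2) (Fin 2) ℤ_[ℓ], ρ γ * Q = Q * X ∧
        ((ℓ : ℤ_[ℓ]) ^ a' ∣ X 0 0 - 1 ∧ (ℓ : ℤ_[ℓ]) ^ a' ∣ X 0 1 ∧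
          (ℓ : ℤ_[ℓ]) ^ b' ∣ X 1 0 ∧ (ℓ : ℤ_[ℓ]) ^ b' ∣ X 1 1 - 1) := by
  refine ⟨1, a + 1, a + k, by simp, by ring, fun γ ↦ ⟨ρ γ, by rw [Matrix.mul_one, Matrix.one_mul],
    ?_⟩⟩
  obtain ⟨⟨z₀, hz₀⟩, ⟨z₁, hz₁⟩⟩ := he γ
  rw [hY γ]
  simp [Matrix.add_apply, Matrix.diagonal_mul]
  exact ⟨⟨z₀, by rw [hz₀]; ring⟩, ⟨z₁, by rw [hz₁]; ring⟩⟩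

/-- **The four moves from a common kernel or cokernel vector modulo `ℓ`.** If
`ρ γ = 1 + diag(ℓᵃ, ℓᵃ⁺ᵏ) Y(γ)` for all `γ` and the reductions `Ȳ(γ)` have a common non-zero
kernel vector or a common non-zero cokernel vector, then one of the four lattice moves applies:
there are `Q` with `det Q ≠ 0` and `a' + b' = 2a + k + 1` with every `ρ γ · Q = Q · X_γ`, `X_γ` of
shape `(a', b')`. [cite: Katz1980, Thm. 1 (proof)] -/
theorem step_of_dichotomy {ρ : Γ →* Matrix (Fin 2) (Fin 2) ℤ_[ℓ]} {a k : ℕ}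
    {Y : Γ → Matrix (Fin 2) (Fin 2) ℤ_[ℓ]}
    (hY : ∀ γ, ρ γ = 1 + Matrix.diagonal ![(ℓ : ℤ_[ℓ]) ^ a, (ℓ : ℤ_[ℓ]) ^ (a + k)] * Y γ)
    (h : (∃ x : Fin 2 → ZMod ℓ, x ≠ 0 ∧ ∀ γ, (toZMod (p := ℓ)).mapMatrix (Y γ) *ᵥ x = 0) ∨
      (∃ w : Fin 2 → ZMod ℓ, w ≠ 0 ∧ ∀ γ, w ᵥ* (toZMod (p := ℓ)).mapMatrix (Y γ) = 0)) :
    ∃ (Q : Matrix (Fin 2) (Fin 2) ℤ_[ℓ]) (a' b' : ℕ), Q.det ≠ 0 ∧ a' + b' = a + (a + k) + 1 ∧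
      ∀ γ, ∃ X : Matrix (Fin 2) (Fin 2) ℤ_[ℓ], ρ γ * Q = Q * X ∧
        ((ℓ : ℤ_[ℓ]) ^ a' ∣ X 0 0 - 1 ∧ (ℓ : ℤ_[ℓ]) ^ a' ∣ X 0 1 ∧
          (ℓ : ℤ_[ℓ]) ^ b' ∣ X 1 0 ∧ (ℓ : ℤ_[ℓ]) ^ b' ∣ X 1 1 - 1) := by
  classical
  set L : ℤ_[ℓ] := (ℓ : ℤ_[ℓ]) with hL
  set Yb : Γ → Matrix (Fin 2) (Fin 2) (ZMod ℓ) := fun γ ↦ (toZMod (p := ℓ)).mapMatrix (Y γ)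
    with hYb
  have hfapp : ∀ γ i j, Yb γ i j = toZMod (Y γ i j) := fun γ i j ↦ rfl
  -- entries of `Ȳ` vanishing modulo `ℓ`, as divisibilities in `ℤ_ℓ`
  have hdvd : ∀ (γ : Γ) (u v : ℤ_[ℓ]) (i j i' j' : Fin 2),
      toZMod u * Yb γ i j + toZMod v * Yb γ i' j' = 0 → L ∣ u * Y γ i j + v * Y γ i' j' := by
    intro γ u v i j i' j' h
    rw [← toZMod_eq_zero_iff_dvd, map_add, map_mul, map_mul, ← hfapp, ← hfapp]
    exact h
  rcases h with ⟨x, hx0, hx⟩ | ⟨w, hw0, hw⟩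
  · -- common kernel vector
    have hxi : ∀ γ (i : Fin 2), Yb γ i 0 * x 0 + Yb γ i 1 * x 1 = 0 := fun γ i ↦ by
      have := congrFun (hx γ) i
      simpa [Matrix.mulVec, dotProduct, Fin.sum_univ_two, hfapp] using this
    by_cases hx1 : x 1 = 0
    · -- `x̄ ∝ (1, 0)`: both first-column entries vanish
      have hx00 : x 0 ≠ 0 := fun h0 ↦ hx0 (funext fun i ↦ by fin_cases i <;> simp [h0, hx1])
      refine step_add_ker_special hY fun γ ↦ ⟨?_, ?_⟩
      · have h := hxi γ 0
        rw [hx1, mul_zero, add_zero] at h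
        have h' : toZMod (1 : ℤ_[ℓ]) * Yb γ 0 0 + toZMod (0 : ℤ_[ℓ]) * Yb γ 0 0 = 0 := by
          rw [map_one, map_zero, one_mul, zero_mul, add_zero]
          exact (mul_eq_zero.mp h).resolve_right hx00
        simpa using hdvd γ 1 0 0 0 0 0 h'
      · have h := hxi γ 1
        rw [hx1, mul_zero, add_zero] at h
        have h' : toZMod (1 : ℤ_[ℓ]) * Yb γ 1 0 + toZMod (0 : ℤ_[ℓ]) * Yb γ 1 0 = 0 := by
          rw [map_one, map_zero, one_mul, zero_mul, add_zero]
          exact (mul_eq_zero.mp h).resolve_right hx00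
        simpa using hdvd γ 1 0 1 0 1 0 h'
    · -- `x̄ ∝ (c̄, 1)`
      set cb : ZMod ℓ := x 0 * (x 1)⁻¹ with hcb
      set c : ℤ_[ℓ] := ((cb.val : ℕ) : ℤ_[ℓ]) with hc
      have hcc : toZMod c = cb := toZMod_natCast_val cb
      have hrow : ∀ γ (i : Fin 2), toZMod c * Yb γ i 0 + toZMod (1 : ℤ_[ℓ]) * Yb γ i 1 = 0 := by
        intro γ i
        rw [hcc, map_one, one_mul, hcb]
        have h := hxi γ i
        have h2 : Yb γ i 1 = -(x 0 * (x 1)⁻¹) * Yb γ i 0 := by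
          have h3 : Yb γ i 1 * x 1 = -(Yb γ i 0 * x 0) := by linear_combination h
          calc Yb γ i 1 = Yb γ i 1 * x 1 * (x 1)⁻¹ := by
                rw [mul_assoc, mul_inv_cancel₀ hx1, mul_one]
            _ = -(x 0 * (x 1)⁻¹) * Yb γ i 0 := by rw [h3]; ring
        linear_combination h2
      refine step_add_ker_generic hY c fun γ ↦ ⟨?_, ?_⟩
      · simpa using hdvd γ c 1 0 0 0 1 (hrow γ 0)
      · simpa using hdvd γ c 1 1 0 1 1 (hrow γ 1)
  · -- common cokernel vector
    have hwj : ∀ γ (j : Fin 2), w 0 * Yb γ 0 j + w 1 * Yb γ 1 j = 0 := fun γ j ↦ by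
      have := congrFun (hw γ) j
      simpa [Matrix.vecMul, dotProduct, Fin.sum_univ_two, hfapp] using this
    by_cases hw1 : w 1 = 0
    · -- `w̄ ∝ (1, 0)`: row `0` vanishes
      have hw00 : w 0 ≠ 0 := fun h0 ↦ hw0 (funext fun i ↦ by fin_cases i <;> simp [h0, hw1])
      refine step_add_im_special hY fun γ ↦ ⟨?_, ?_⟩
      · have h := hwj γ 0
        rw [hw1, zero_mul, add_zero] at h
        have h' : toZMod (1 : ℤ_[ℓ]) * Yb γ 0 0 + toZMod (0 : ℤ_[ℓ]) * Yb γ 0 0 = 0 := by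
          rw [map_one, map_zero, one_mul, zero_mul, add_zero]
          exact (mul_eq_zero.mp h).resolve_left hw00
        simpa using hdvd γ 1 0 0 0 0 0 h'
      · have h := hwj γ 1
        rw [hw1, zero_mul, add_zero] at h
        have h' : toZMod (1 : ℤ_[ℓ]) * Yb γ 0 1 + toZMod (0 : ℤ_[ℓ]) * Yb γ 0 1 = 0 := by
          rw [map_one, map_zero, one_mul, zero_mul, add_zero]
          exact (mul_eq_zero.mp h).resolve_left hw00
        simpa using hdvd γ 1 0 0 1 0 1 h'
    · -- `w̄ ∝ (−ē, 1)`: row `1 ≡ ē ·` row `0`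
      set eb : ZMod ℓ := -(w 0 * (w 1)⁻¹) with heb
      set e : ℤ_[ℓ] := ((eb.val : ℕ) : ℤ_[ℓ]) with he
      have hee : toZMod e = eb := toZMod_natCast_val eb
      have hrow : ∀ γ (j : Fin 2),
          toZMod (1 : ℤ_[ℓ]) * Yb γ 1 j + toZMod (-e) * Yb γ 0 j = 0 := by
        intro γ j
        rw [map_neg, hee, map_one, one_mul, heb]
        have h := hwj γ j
        have h2 : Yb γ 1 j = -(w 0 * (w 1)⁻¹) * Yb γ 0 j := by
          have h3 : w 1 * Yb γ 1 j = -(w 0 * Yb γ 0 j) := by linear_combination h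
          calc Yb γ 1 j = (w 1)⁻¹ * (w 1 * Yb γ 1 j) := by
                rw [← mul_assoc, inv_mul_cancel₀ hw1, one_mul]
            _ = -(w 0 * (w 1)⁻¹) * Yb γ 0 j := by rw [h3]; ring
        linear_combination h2
      refine step_add_im_generic hY e fun γ ↦ ⟨?_, ?_⟩
      · have := hdvd γ 1 (-e) 1 0 0 0 (hrow γ 0)
        rw [one_mul, neg_mul, ← sub_eq_add_neg] at this
        exact this
      · have := hdvd γ 1 (-e) 1 1 0 1 (hrow γ 1)
        rw [one_mul, neg_mul, ← sub_eq_add_neg] at this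
        exact this

/-- **The inductive step for shapes `(a, a + k)`, `a ≥ 1`** (Katz 1981, Thm. 1, proof): if
`ρ : Γ →* M₂(ℤ_ℓ)` has shape `(a, a + k)` with `a ≥ 1` and `det(1 − ρ γ) ≡ 0 (mod ℓ²ᵃ⁺ᵏ⁺¹)` for
all `γ`, there are an integral `Q` with `det Q ≠ 0` and `a' + b' = 2a + k + 1` such that every
`ρ γ · Q = Q · X_γ` with `X_γ` of shape `(a', b')`. Proof: `γ ↦ Ȳ(γ)` is additive with singular
values; Part I gives a common kernel or cokernel vector; normalise and apply one of the four
moves above. [cite: Katz1980, Thm. 1 (proof)] [cite: CullinanKenneyVoight2022, Thm. 2.3.1] -/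
theorem step_add {ρ : Γ →* Matrix (Fin 2) (Fin 2) ℤ_[ℓ]} {a k : ℕ} (ha : 1 ≤ a)
    (hshape : ∀ γ, (ℓ : ℤ_[ℓ]) ^ a ∣ ρ γ 0 0 - 1 ∧ (ℓ : ℤ_[ℓ]) ^ a ∣ ρ γ 0 1 ∧
      (ℓ : ℤ_[ℓ]) ^ (a + k) ∣ ρ γ 1 0 ∧ (ℓ : ℤ_[ℓ]) ^ (a + k) ∣ ρ γ 1 1 - 1)
    (hdet : ∀ γ, (ℓ : ℤ_[ℓ]) ^ (a + (a + k) + 1) ∣ (1 - ρ γ).det) :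
    ∃ (Q : Matrix (Fin 2) (Fin 2) ℤ_[ℓ]) (a' b' : ℕ), Q.det ≠ 0 ∧ a' + b' = a + (a + k) + 1 ∧
      ∀ γ, ∃ X : Matrix (Fin 2) (Fin 2) ℤ_[ℓ], ρ γ * Q = Q * X ∧
        ((ℓ : ℤ_[ℓ]) ^ a' ∣ X 0 0 - 1 ∧ (ℓ : ℤ_[ℓ]) ^ a' ∣ X 0 1 ∧
          (ℓ : ℤ_[ℓ]) ^ b' ∣ X 1 0 ∧ (ℓ : ℤ_[ℓ]) ^ b' ∣ X 1 1 - 1) := by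
  classical
  have hl : (ℓ : ℤ_[ℓ]) ≠ 0 := Nat.cast_ne_zero.mpr hℓ.out.ne_zero
  set L : ℤ_[ℓ] := (ℓ : ℤ_[ℓ]) with hL
  set D : Matrix (Fin 2) (Fin 2) ℤ_[ℓ] := Matrix.diagonal ![L ^ a, L ^ (a + k)] with hD
  -- `ρ γ = 1 + D Y(γ)`
  have hY' : ∀ γ, ∃ Y : Matrix (Fin 2) (Fin 2) ℤ_[ℓ], ρ γ = 1 + D * Y := fun γ ↦
    (exists_eq_one_add_diagonal_mul_iff a (a + k) (ρ γ)).mpr (hshape γ)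
  choose Y hY using hY'
  -- the composition law `Y(γδ) = Y(γ) + Y(δ) + Y(γ) D Y(δ)`
  have hcomp : ∀ γ δ, Y (γ * δ) = Y γ + Y δ + Y γ * D * Y δ := by
    intro γ δ
    apply diagonal_pow_mul_injective a (a + k)
    rw [← hD]
    have h := hY (γ * δ)
    rw [map_mul, hY γ, hY δ] at h
    have h2 : (1 + D * Y γ) * (1 + D * Y δ) = 1 + D * (Y γ + Y δ + Y γ * D * Y δ) := by
      noncomm_ring
    exact add_left_cancel (h2.symm.trans h).symm
  -- reduction modulo `ℓ`: `Ȳ` is additive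
  have hL0 : toZMod (p := ℓ) L = 0 := by rw [hL, map_natCast, ZMod.natCast_self]
  have hD0 : (toZMod (p := ℓ)).mapMatrix D = 0 := by
    ext i j
    rw [RingHom.mapMatrix_apply, Matrix.map_apply, hD]
    fin_cases i <;> fin_cases j <;>
      simp [Matrix.diagonal, map_pow, hL0, zero_pow (by omega : a ≠ 0),
        zero_pow (by omega : a + k ≠ 0)]
  set Yb : Γ → Matrix (Fin 2) (Fin 2) (ZMod ℓ) := fun γ ↦ (toZMod (p := ℓ)).mapMatrix (Y γ)
    with hYb
  have hadd : ∀ γ δ, Yb (γ * δ) = Yb γ + Yb δ := by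
    intro γ δ
    simp only [hYb]
    rw [hcomp, map_add, map_add, map_mul, map_mul, hD0, mul_zero, zero_mul, add_zero]
  -- every `Ȳ(γ)` is singular
  have hdet0 : ∀ γ, (Yb γ).det = 0 := by
    intro γ
    have h1 : (Yb γ).det = toZMod (Y γ).det := (RingHom.map_det _ _).symm
    rw [h1, toZMod_eq_zero_iff_dvd]
    have h2 := hdet γ
    rw [hY γ, hD, det_one_sub_one_add_diagonal_mul, pow_succ] at h2
    exact (mul_dvd_mul_iff_left (pow_ne_zero _ hl)).mp h2
  exact step_of_dichotomy hY (exists_common_mulVec_eq_zero_or_common_vecMul_eq_zero Yb hadd hdet0)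

end StepAdd

/-! ## IV. The Borel case `a = 0 < b`: the four coordinate functions modulo `ℓ`

For `ρ` of shape `(0, n)`, `n ≥ 1`, write `ρ γ = 1 + diag(1, ℓⁿ) Y(γ)` and
`Ȳ(γ) = (ā b̄; c̄ d̄)(γ)`. The composition law `Y(γδ) = Y(γ) + Y(δ) + Y(γ) diag(1, ℓⁿ) Y(δ)`
reads, modulo `ℓ`: `a(γδ) = a + a' + a a'`, `b(γδ) = b + b' + a b'`, `c(γδ) = c + c' + c a'`,
`d(γδ) = d + d' + c b'` (primes for the values at `δ`), and `det(1 − ρ γ) ≡ 0 (mod ℓⁿ⁺¹)` reads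
`a d = b c`. The purely algebraic lemma below turns these into one of the four kernel/cokernel
conditions of Part III (with `a = 0`, `k = n`). -/

section Borel

variable {ℓ : ℕ} [hℓ : Fact ℓ.Prime] {Γ : Type*} [Group Γ]

/-- **The Borel case of Katz's induction, as algebra of four functions `Γ → 𝔽_ℓ`.** If
`a b c d : Γ → 𝔽_ℓ` satisfy `a(γδ) = a γ + a δ + a γ a δ`, `b(γδ) = b γ + b δ + a γ b δ`,
`c(γδ) = c γ + c δ + c γ a δ`, `d(γδ) = d γ + d δ + c γ b δ`, `a 1 = 0`, and `a d = b c`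
pointwise, then: `a = c = 0`, or `a = b = 0`, or `x a + b = x c + d = 0` for a constant `x`, or
`c = e a`, `d = e b` for a constant `e`. (Proof: module docstring of the file and the comments;
the subgroup `N = {a = 0}`, the element `δ = (γ₀γ)(γγ₀)⁻¹ ∈ N`, and twice "a group is not the
union of two proper subgroups".) [cite: Katz1980, Thm. 1 (proof)] -/
theorem borel_four_functions (a b c d : Γ → ZMod ℓ)
    (ha : ∀ γ δ, a (γ * δ) = a γ + a δ + a γ * a δ)
    (hb : ∀ γ δ, b (γ * δ) = b γ + b δ + a γ * b δ)
    (hc : ∀ γ δ, c (γ * δ) = c γ + c δ + c γ * a δ)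
    (hd : ∀ γ δ, d (γ * δ) = d γ + d δ + c γ * b δ)
    (h1 : a 1 = 0) (hdet : ∀ γ, a γ * d γ = b γ * c γ) :
    (∀ γ, a γ = 0 ∧ c γ = 0) ∨ (∀ γ, a γ = 0 ∧ b γ = 0) ∨
      (∃ x : ZMod ℓ, ∀ γ, x * a γ + b γ = 0 ∧ x * c γ + d γ = 0) ∨
      (∃ e : ZMod ℓ, ∀ γ, c γ = e * a γ ∧ d γ = e * b γ) := by
  -- the multiplicative character `u = 1 + a`
  have hu_mul : ∀ γ δ, (1 + a (γ * δ)) = (1 + a γ) * (1 + a δ) := fun γ δ ↦ by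
    rw [ha]; ring
  have hu_inv : ∀ γ, (1 + a γ) * (1 + a γ⁻¹) = 1 := fun γ ↦ by
    rw [← hu_mul, mul_inv_cancel, h1, add_zero]
  have hu : ∀ γ, 1 + a γ ≠ 0 := fun γ h0 ↦ by simpa [h0] using hu_inv γ
  have hb1 : b 1 = 0 := by
    have := hb 1 1
    rw [mul_one, h1, zero_mul, add_zero] at this
    simpa using this
  have hc1 : c 1 = 0 := by
    have := hc 1 1
    rw [mul_one, h1, mul_zero, add_zero] at this
    simpa using this
  -- `a` vanishes on "commutators": `a ((γ δ) (δ γ)⁻¹) = 0`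
  have ha_comm : ∀ γ δ, a (γ * δ * (δ * γ)⁻¹) = 0 := by
    intro γ δ
    have h2 : (1 + a (γ * δ * (δ * γ)⁻¹)) * (1 + a (δ * γ)) = 1 + a (γ * δ) := by
      rw [← hu_mul, inv_mul_cancel_right]
    rw [hu_mul γ δ, hu_mul δ γ, mul_comm (1 + a δ)] at h2
    have h3 : (1 + a (γ * δ * (δ * γ)⁻¹)) = 1 :=
      mul_right_cancel₀ (mul_ne_zero (hu γ) (hu δ)) (h2.trans (one_mul _).symm)
    simpa using h3
  -- a generic "subgroup-union" step: `a ≢ 0`, `f` additive with `a f = 0` forces `f = 0`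
  have hunion : ∀ (f : Γ → ZMod ℓ), (∀ γ δ, f (γ * δ) = f γ + f δ) → (∀ γ, a γ * f γ = 0) →
      (∃ γ₀, a γ₀ ≠ 0) → ∀ γ, f γ = 0 := by
    intro f hf haf ⟨γ₀, hγ₀⟩
    rcases forall_or_forall_of_forall_or' (A := fun γ ↦ a γ = 0) (B := fun γ ↦ f γ = 0)
        (fun γ ↦ mul_eq_zero.mp (haf γ)) (fun γ₁ γ₂ h12 h2 ↦ by
          have := ha γ₁ γ₂; rw [h12, h2] at this; linear_combination -this)
        (fun γ₁ γ₂ h12 h2 ↦ by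
          have := hf γ₁ γ₂; rw [h12, h2] at this; linear_combination -this) with h | h
    · exact absurd (h γ₀) hγ₀
    · exact h
  by_cases hA : ∀ γ, a γ = 0
  · -- Case A: `a = 0`; `b`, `c` additive with `b c = 0`
    have hb' : ∀ γ δ, b (γ * δ) = b γ + b δ := fun γ δ ↦ by rw [hb, hA, zero_mul, add_zero]
    have hc' : ∀ γ δ, c (γ * δ) = c γ + c δ := fun γ δ ↦ by rw [hc, hA, mul_zero, add_zero]
    rcases forall_or_forall_of_forall_or' (A := fun γ ↦ c γ = 0) (B := fun γ ↦ b γ = 0)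
        (fun γ ↦ by
          have := hdet γ
          rw [hA, zero_mul] at this
          exact (mul_eq_zero.mp this.symm).symm)
        (fun γ₁ γ₂ h12 h2 ↦ by
          have := hc' γ₁ γ₂; rw [h12, h2] at this; linear_combination -this)
        (fun γ₁ γ₂ h12 h2 ↦ by
          have := hb' γ₁ γ₂; rw [h12, h2] at this; linear_combination -this) with h | h
    · exact Or.inl fun γ ↦ ⟨hA γ, h γ⟩
    · exact Or.inr (Or.inl fun γ ↦ ⟨hA γ, h γ⟩)
  push Not at hA
  obtain ⟨γ₀, ha₀⟩ := hA
  by_cases hB1 : ∀ γ, a γ = 0 → b γ = 0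
  · -- Case B1: the kernel vector `(x, 1)`, `x = −b₀/a₀`
    right; right; left
    set x : ZMod ℓ := -(b γ₀ * (a γ₀)⁻¹) with hx
    refine ⟨x, ?_⟩
    set b' : Γ → ZMod ℓ := fun γ ↦ x * a γ + b γ with hb'def
    have hb'law : ∀ γ δ, b' (γ * δ) = b' γ + b' δ + a γ * b' δ := fun γ δ ↦ by
      simp only [hb'def, ha, hb]; ring
    have hb'1 : b' 1 = 0 := by simp [hb'def, h1, hb1]
    have hb'₀ : b' γ₀ = 0 := by
      simp only [hb'def, hx]
      rw [neg_mul, mul_assoc, inv_mul_cancel₀ ha₀, mul_one, neg_add_cancel]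
    have hb'inv : ∀ ε, b' ε⁻¹ = -((1 + a ε)⁻¹ * b' ε) := fun ε ↦ by
      have h2 := hb'law ε ε⁻¹
      rw [mul_inv_cancel, hb'1] at h2
      have h3 : (1 + a ε) * b' ε⁻¹ = -b' ε := by linear_combination -h2
      calc b' ε⁻¹ = (1 + a ε)⁻¹ * ((1 + a ε) * b' ε⁻¹) := by
            rw [← mul_assoc, inv_mul_cancel₀ (hu ε), one_mul]
        _ = -((1 + a ε)⁻¹ * b' ε) := by rw [h3, mul_neg]
    have hb'N : ∀ γ, a γ = 0 → b' γ = 0 := fun γ hγ ↦ by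
      simp only [hb'def, hγ, mul_zero, zero_add]; exact hB1 γ hγ
    -- `b' = 0` everywhere: evaluate at `δ = (γ₀ γ)(γ γ₀)⁻¹ ∈ N`
    have hb'0 : ∀ γ, b' γ = 0 := by
      intro γ
      have hδ := hb'N _ (ha_comm γ₀ γ)
      rw [hb'law, hb'inv, hb'law γ γ₀, hb'law γ₀ γ, hb'₀, ha γ₀ γ, ha γ γ₀] at hδ
      -- `hδ : u₀ b'γ − u(γ₀γ) u(γγ₀)⁻¹ b'γ = 0`, i.e. `a₀ b'γ = 0`
      have hne : (1 + (a γ + a γ₀ + a γ * a γ₀) : ZMod ℓ) ≠ 0 := by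
        rw [show (1 + (a γ + a γ₀ + a γ * a γ₀) : ZMod ℓ) = (1 + a γ) * (1 + a γ₀) by ring]
        exact mul_ne_zero (hu γ) (hu γ₀)
      have hV : (1 + (a γ + a γ₀ + a γ * a γ₀)) * (1 + (a γ + a γ₀ + a γ * a γ₀))⁻¹ = 1 :=
        mul_inv_cancel₀ hne
      have h5 : a γ₀ * b' γ = 0 := by linear_combination hδ + b' γ * hV
      exact (mul_eq_zero.mp h5).resolve_left ha₀
    -- then `d' = x c + d` is additive with `a d' = 0`
    set d' : Γ → ZMod ℓ := fun γ ↦ x * c γ + d γ with hd'def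
    have hd'law : ∀ γ δ, d' (γ * δ) = d' γ + d' δ := fun γ δ ↦ by
      have h2 : d' (γ * δ) = d' γ + d' δ + c γ * b' δ := by
        simp only [hd'def, hb'def, hc, hd]; ring
      rw [h2, hb'0, mul_zero, add_zero]
    have had' : ∀ γ, a γ * d' γ = 0 := fun γ ↦ by
      have h2 : a γ * d' γ = c γ * b' γ := by
        simp only [hd'def, hb'def]; linear_combination hdet γ
      rw [h2, hb'0, mul_zero]
    have hd'0 := hunion d' hd'law had' ⟨γ₀, ha₀⟩
    exact fun γ ↦ ⟨hb'0 γ, hd'0 γ⟩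
  · -- Case B2: some `γ₁ ∈ N` has `b γ₁ ≠ 0`
    push Not at hB1
    obtain ⟨γ₁, ha₁, hb₁⟩ := hB1
    right; right; right
    -- `c = 0` on `N`
    have hcN : ∀ γ, a γ = 0 → c γ = 0 := by
      intro γ₂ ha₂
      by_contra hc₂
      have hc₁ : c γ₁ = 0 := by
        have := hdet γ₁; rw [ha₁, zero_mul] at this
        exact (mul_eq_zero.mp this.symm).resolve_left hb₁
      have hb₂ : b γ₂ = 0 := by
        have := hdet γ₂; rw [ha₂, zero_mul] at this
        exact (mul_eq_zero.mp this.symm).resolve_right hc₂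
      have h12 := hdet (γ₁ * γ₂)
      rw [ha, hb, hc, ha₁, ha₂, hc₁, hb₂] at h12
      simp only [add_zero, zero_mul, mul_zero, zero_add] at h12
      exact mul_ne_zero hb₁ hc₂ h12.symm
    -- powers of `γ₁` stay in `N` with `b (γ₁ ^ m) = m • b γ₁`
    have hpow : ∀ m : ℕ, a (γ₁ ^ m) = 0 ∧ b (γ₁ ^ m) = (m : ZMod ℓ) * b γ₁ := by
      intro m
      induction m with
      | zero => simp [h1, hb1]
      | succ m ih =>
        rw [pow_succ, ha, hb, ih.1, ih.2, ha₁]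
        constructor
        · ring
        · push_cast; ring
    -- adjust `γ₀` so that `b γ₀' = 0`
    set t : ZMod ℓ := -(b γ₀ * (1 + a γ₀)⁻¹) with ht
    set m : ℕ := (t * (b γ₁)⁻¹).val with hm
    set γ₀' : Γ := γ₀ * γ₁ ^ m with hγ₀'
    have ha₀' : a γ₀' = a γ₀ := by rw [hγ₀', ha, (hpow m).1]; ring
    have ha₀'ne : a γ₀' ≠ 0 := ha₀'.symm ▸ ha₀
    have hb₀' : b γ₀' = 0 := by
      rw [hγ₀', hb, (hpow m).2, hm, ZMod.natCast_zmod_val, mul_assoc, inv_mul_cancel₀ hb₁,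
        mul_one, ht]
      rw [show b γ₀ + -(b γ₀ * (1 + a γ₀)⁻¹) + a γ₀ * -(b γ₀ * (1 + a γ₀)⁻¹) =
        b γ₀ - (1 + a γ₀) * (b γ₀ * (1 + a γ₀)⁻¹) by ring]
      rw [mul_comm (b γ₀), ← mul_assoc, mul_inv_cancel₀ (hu γ₀), one_mul, sub_self]
    have hd₀' : d γ₀' = 0 := by
      have := hdet γ₀'; rw [hb₀', zero_mul] at this
      exact (mul_eq_zero.mp this).resolve_left ha₀'ne
    -- `e = c₀'/a₀'`; `c' = c − e a`, `d' = d − e b`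
    set e : ZMod ℓ := c γ₀' * (a γ₀')⁻¹ with hedef
    refine ⟨e, ?_⟩
    set c' : Γ → ZMod ℓ := fun γ ↦ c γ - e * a γ with hc'def
    have hc'law : ∀ γ δ, c' (γ * δ) = c' γ * (1 + a δ) + c' δ := fun γ δ ↦ by
      simp only [hc'def, ha, hc]; ring
    have hc'1 : c' 1 = 0 := by simp [hc'def, h1, hc1]
    have hc'₀ : c' γ₀' = 0 := by
      simp only [hc'def, hedef]
      rw [mul_assoc, inv_mul_cancel₀ ha₀'ne, mul_one, sub_self]
    have hc'N : ∀ γ, a γ = 0 → c' γ = 0 := fun γ hγ ↦ by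
      simp only [hc'def, hγ, mul_zero, sub_zero]; exact hcN γ hγ
    have hc'inv : ∀ ε, c' ε⁻¹ = -(c' ε * (1 + a ε)⁻¹) := fun ε ↦ by
      have h2 := hc'law ε ε⁻¹
      rw [mul_inv_cancel, hc'1] at h2
      -- `0 = c' ε u(ε⁻¹) + c' ε⁻¹`, and `u(ε⁻¹) = u(ε)⁻¹`
      have h3 : (1 + a ε⁻¹) = (1 + a ε)⁻¹ := by
        rw [eq_comm, inv_eq_of_mul_eq_one_right (hu_inv ε)]
      rw [h3] at h2
      linear_combination -h2
    have hc'0 : ∀ γ, c' γ = 0 := by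
      intro γ
      have hδ := hc'N _ (ha_comm γ γ₀')
      rw [hc'law, hc'inv, hc'law γ₀' γ, hc'law γ γ₀', hc'₀, ha γ₀' γ] at hδ
      -- `1 + a((γ₀'γ)⁻¹) = u(γ₀'γ)⁻¹`
      have hne : (1 + (a γ₀' + a γ + a γ₀' * a γ) : ZMod ℓ) ≠ 0 := by
        rw [show (1 + (a γ₀' + a γ + a γ₀' * a γ) : ZMod ℓ) = (1 + a γ₀') * (1 + a γ) by ring]
        exact mul_ne_zero (hu γ₀') (hu γ)
      have h3 : 1 + a (γ₀' * γ)⁻¹ = (1 + (a γ₀' + a γ + a γ₀' * a γ))⁻¹ := by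
        have h4 := hu_inv (γ₀' * γ)
        rw [ha γ₀' γ] at h4
        exact (inv_eq_of_mul_eq_one_right h4).symm
      rw [h3] at hδ
      have h5 : (1 + (a γ₀' + a γ + a γ₀' * a γ))⁻¹ * (a γ₀' * c' γ) = 0 := by
        linear_combination hδ
      exact (mul_eq_zero.mp ((mul_eq_zero.mp h5).resolve_left (inv_ne_zero hne))).resolve_left
        ha₀'ne
    -- then `d' = d − e b` is additive with `a d' = 0`
    set d' : Γ → ZMod ℓ := fun γ ↦ d γ - e * b γ with hd'def
    have hd'law : ∀ γ δ, d' (γ * δ) = d' γ + d' δ := fun γ δ ↦ by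
      have h2 : d' (γ * δ) = d' γ + d' δ + c' γ * b δ := by
        simp only [hd'def, hc'def, hb, hd]; ring
      rw [h2, hc'0, zero_mul, add_zero]
    have had' : ∀ γ, a γ * d' γ = 0 := fun γ ↦ by
      have h2 : a γ * d' γ = b γ * c' γ := by
        simp only [hd'def, hc'def]; linear_combination hdet γ
      rw [h2, hc'0, mul_zero]
    have hd'0 := hunion d' hd'law had' ⟨γ₀', ha₀'ne⟩
    intro γ
    constructor
    · have := hc'0 γ; simp only [hc'def] at this; linear_combination this
    · have := hd'0 γ; simp only [hd'def] at this; linear_combination this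

end Borel

/-! ## V. The base case `n = 0`: plane representations over a field all of whose elements
have eigenvalue `1`

For `ρ̄ : Γ →* M₂(F)` with `det(1 − ρ̄ γ) = 0` for all `γ`, either a non-zero vector is fixed by
every `ρ̄ γ`, or a non-zero covector is (`w ρ̄ γ = w` for all `γ`): by
`Literature.RepresentationTheory.FiniteGroups.Representation.exists_finrank_eq_one_invariant_of_forall_exists_fixed`
there is a stable line `L = F v₀`; a fixed vector of `ρ̄ γ` inside `L` forces `ρ̄ γ v₀ = v₀`, one
outside `L` forces `ρ̄ γ` to act trivially on `F² / L`, i.e. `w₀ ρ̄ γ = w₀` for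
`w₀ = (v₀,₁, −v₀,₀)`; both conditions define subgroups of `Γ`. -/

section Base

variable {F : Type*} [Field F] {Γ : Type*} [Group Γ]

/-- Two vectors of `F²` with vanishing cross product are proportional, the first being
non-zero. [folklore] -/
theorem exists_eq_smul_of_cross_eq_zero {v₀ v : Fin 2 → F} (hv₀ : v₀ ≠ 0)
    (h : v₀ 1 * v 0 - v₀ 0 * v 1 = 0) : ∃ t : F, v = t • v₀ := by
  by_cases h0 : v₀ 0 = 0
  · have h1 : v₀ 1 ≠ 0 := fun h1 ↦ hv₀ (funext fun i ↦ by fin_cases i <;> simp [h0, h1])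
    have hv0 : v 0 = 0 := by
      rw [h0, zero_mul, sub_zero] at h
      exact (mul_eq_zero.mp h).resolve_left h1
    refine ⟨v 1 * (v₀ 1)⁻¹, funext fun i ↦ ?_⟩
    fin_cases i
    · simp [hv0, h0]
    · simp only [Fin.mk_one, Fin.isValue, Pi.smul_apply, smul_eq_mul]
      rw [mul_assoc, inv_mul_cancel₀ h1, mul_one]
  · have hinv : (v₀ 0)⁻¹ * v₀ 0 = 1 := inv_mul_cancel₀ h0
    refine ⟨v 0 * (v₀ 0)⁻¹, funext fun i ↦ ?_⟩
    fin_cases i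
    · simp only [Fin.zero_eta, Fin.isValue, Pi.smul_apply, smul_eq_mul]
      rw [mul_assoc, inv_mul_cancel₀ h0, mul_one]
    · simp only [Fin.mk_one, Fin.isValue, Pi.smul_apply, smul_eq_mul]
      linear_combination (-(v₀ 0)⁻¹) * h - v 1 * hinv

/-- **Base case of Katz's induction: a common fixed vector or a common fixed covector.** Let
`F` be a field, `Γ` a group and `ρ̄ : Γ →* M₂(F)` a homomorphism with `det(1 − ρ̄ γ) = 0` for
every `γ` (every element of the image has eigenvalue `1`). Then either some `x ≠ 0` has
`ρ̄ γ x = x` for all `γ`, or some `w ≠ 0` has `w ρ̄ γ = w` for all `γ`. (From the invariant line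
of `exists_finrank_eq_one_invariant_of_forall_exists_fixed` and "a group is not the union of two
proper subgroups"; this is the case `n = 1` of Katz's theorem, cf. Cullinan–Kenney–Voight 2022,
Lemma 2.3.5.) [cite: Katz1980, Thm. 1 (proof)] [cite: CullinanKenneyVoight2022, Lemma 2.3.5] -/
theorem exists_common_fixed_or_cofixed (ρb : Γ →* Matrix (Fin 2) (Fin 2) F)
    (hdet : ∀ γ, (1 - ρb γ).det = 0) :
    (∃ x : Fin 2 → F, x ≠ 0 ∧ ∀ γ, ρb γ *ᵥ x = x) ∨
      (∃ w : Fin 2 → F, w ≠ 0 ∧ ∀ γ, w ᵥ* ρb γ = w) := by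
  classical
  -- the representation on `F²`
  let R : Representation F Γ (Fin 2 → F) :=
    { toFun := fun γ ↦ Matrix.toLin' (ρb γ)
      map_one' := by simp only [map_one, Matrix.toLin'_one]; rfl
      map_mul' := fun γ δ ↦ by simp only [map_mul, Matrix.toLin'_mul]; rfl }
  have hR : ∀ γ v, R γ v = ρb γ *ᵥ v := fun γ v ↦ Matrix.toLin'_apply (ρb γ) v
  -- every element fixes a non-zero vector
  have hfix : ∀ γ, ∃ v : Fin 2 → F, v ≠ 0 ∧ R γ v = v := by
    intro γ
    obtain ⟨v, hv0, hv⟩ := Matrix.exists_mulVec_eq_zero_iff.mpr (hdet γ)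
    refine ⟨v, hv0, ?_⟩
    rw [hR]
    rw [Matrix.sub_mulVec, Matrix.one_mulVec, sub_eq_zero] at hv
    exact hv.symm
  obtain ⟨L, hL1, hL⟩ :=
    Literature.RepresentationTheory.FiniteGroups.Representation.exists_finrank_eq_one_invariant_of_forall_exists_fixed
      R (Module.finrank_fin_fun F) hfix
  -- a generator `v₀` of `L`
  have hbot : L ≠ ⊥ := by
    rintro rfl
    simp at hL1
  obtain ⟨v₀, hv₀L, hv₀⟩ := Submodule.exists_mem_ne_zero_of_ne_bot hbot
  have hLeq : L = F ∙ v₀ := eq_span_singleton_of_mem_of_finrank_eq_one hL1 hv₀L hv₀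
  have hχ : ∀ γ, ∃ c : F, ρb γ *ᵥ v₀ = c • v₀ := fun γ ↦ by
    have hmem : ρb γ *ᵥ v₀ ∈ F ∙ v₀ := hLeq ▸ (hR γ v₀ ▸ hL γ v₀ hv₀L)
    obtain ⟨c, hc⟩ := Submodule.mem_span_singleton.mp hmem
    exact ⟨c, hc.symm⟩
  -- the covector `w₀` vanishing on `L`
  set w₀ : Fin 2 → F := ![v₀ 1, -v₀ 0] with hw₀
  have hw₀0 : w₀ ≠ 0 := by
    intro h
    apply hv₀
    have h0 : v₀ 1 = 0 := by simpa [hw₀] using congrFun h 0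
    have h1 : v₀ 0 = 0 := by simpa [hw₀] using congrFun h 1
    funext i
    fin_cases i <;> simp [h0, h1]
  have hdot : ∀ v : Fin 2 → F, w₀ ⬝ᵥ v = v₀ 1 * v 0 - v₀ 0 * v 1 := fun v ↦ by
    rw [Matrix.vec2_dotProduct]
    simp [hw₀]
    ring
  have hw₀v₀ : w₀ ⬝ᵥ v₀ = 0 := by rw [hdot]; ring
  -- the dichotomy, elementwise
  have hdich : ∀ γ, ρb γ *ᵥ v₀ = v₀ ∨ w₀ ᵥ* ρb γ = w₀ := by
    intro γ
    obtain ⟨v, hv0, hv⟩ := hfix γ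
    rw [hR] at hv
    by_cases hcross : v₀ 1 * v 0 - v₀ 0 * v 1 = 0
    · -- the fixed vector lies on `L`
      left
      obtain ⟨t, rfl⟩ := exists_eq_smul_of_cross_eq_zero hv₀ hcross
      have ht : t ≠ 0 := by
        rintro rfl
        exact hv0 (zero_smul _ _)
      rw [Matrix.mulVec_smul] at hv
      have h2 := congrArg (fun u ↦ t⁻¹ • u) hv
      simpa only [smul_smul, inv_mul_cancel₀ ht, one_smul] using h2
    · -- the fixed vector lies off `L`: `ρ̄ γ` is trivial on `F² / L`
      right
      obtain ⟨c, hc⟩ := hχ γ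
      have hu : (w₀ ᵥ* ρb γ) ⬝ᵥ v₀ = 0 := by
        rw [← Matrix.dotProduct_mulVec, hc, dotProduct_smul, hw₀v₀, smul_zero]
      obtain ⟨s, hs⟩ := exists_eq_smul_of_cross_eq_zero (v₀ := w₀) (v := w₀ ᵥ* ρb γ) hw₀0 (by
        rw [Matrix.vec2_dotProduct] at hu
        simp only [hw₀, Matrix.cons_val_zero, Matrix.cons_val_one, Matrix.cons_val_fin_one]
        linear_combination -hu)
      have h1 : (w₀ ᵥ* ρb γ) ⬝ᵥ v = w₀ ⬝ᵥ v := by rw [← Matrix.dotProduct_mulVec, hv]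
      rw [hs, smul_dotProduct, smul_eq_mul, hdot] at h1
      have hs1 : s = 1 := by
        have : (s - 1) * (v₀ 1 * v 0 - v₀ 0 * v 1) = 0 := by linear_combination h1
        exact sub_eq_zero.mp ((mul_eq_zero.mp this).resolve_right hcross)
      rw [hs, hs1, one_smul]
  -- both conditions define subgroups
  have hA : ∀ γ₁ γ₂, ρb (γ₁ * γ₂) *ᵥ v₀ = v₀ → ρb γ₂ *ᵥ v₀ = v₀ → ρb γ₁ *ᵥ v₀ = v₀ := by
    intro γ₁ γ₂ h12 h2
    rwa [map_mul, ← Matrix.mulVec_mulVec, h2] at h12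
  have hB : ∀ γ₁ γ₂, w₀ ᵥ* ρb (γ₁ * γ₂) = w₀ → w₀ ᵥ* ρb γ₁ = w₀ → w₀ ᵥ* ρb γ₂ = w₀ := by
    intro γ₁ γ₂ h12 h1
    rwa [map_mul, ← Matrix.vecMul_vecMul, h1] at h12
  rcases forall_or_forall_of_forall_or' hdich hA hB with h | h
  · exact Or.inl ⟨v₀, hv₀, h⟩
  · exact Or.inr ⟨w₀, hw₀0, h⟩

end Base

/-! ## VI. The inductive step in general -/

section Step

variable {ℓ : ℕ} [hℓ : Fact ℓ.Prime] {Γ : Type*} [Group Γ]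

open PadicInt

/-- **The Borel case `(0, n)`, `n ≥ 1`, of the inductive step.** Writing
`ρ γ = 1 + diag(1, ℓⁿ) Y(γ)`, the residues of the four entries of `Y` satisfy the hypotheses of
`borel_four_functions`, whose four conclusions are the four kernel/cokernel conditions of
`step_of_dichotomy`. [cite: Katz1980, Thm. 1 (proof)] -/
theorem step_borel {ρ : Γ →* Matrix (Fin 2) (Fin 2) ℤ_[ℓ]} {n : ℕ} (hn : 1 ≤ n)
    (hshape : ∀ γ, (ℓ : ℤ_[ℓ]) ^ 0 ∣ ρ γ 0 0 - 1 ∧ (ℓ : ℤ_[ℓ]) ^ 0 ∣ ρ γ 0 1 ∧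
      (ℓ : ℤ_[ℓ]) ^ (0 + n) ∣ ρ γ 1 0 ∧ (ℓ : ℤ_[ℓ]) ^ (0 + n) ∣ ρ γ 1 1 - 1)
    (hdet : ∀ γ, (ℓ : ℤ_[ℓ]) ^ (0 + (0 + n) + 1) ∣ (1 - ρ γ).det) :
    ∃ (Q : Matrix (Fin 2) (Fin 2) ℤ_[ℓ]) (a' b' : ℕ), Q.det ≠ 0 ∧ a' + b' = 0 + (0 + n) + 1 ∧
      ∀ γ, ∃ X : Matrix (Fin 2) (Fin 2) ℤ_[ℓ], ρ γ * Q = Q * X ∧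
        ((ℓ : ℤ_[ℓ]) ^ a' ∣ X 0 0 - 1 ∧ (ℓ : ℤ_[ℓ]) ^ a' ∣ X 0 1 ∧
          (ℓ : ℤ_[ℓ]) ^ b' ∣ X 1 0 ∧ (ℓ : ℤ_[ℓ]) ^ b' ∣ X 1 1 - 1) := by
  classical
  have hl : (ℓ : ℤ_[ℓ]) ≠ 0 := Nat.cast_ne_zero.mpr hℓ.out.ne_zero
  set L : ℤ_[ℓ] := (ℓ : ℤ_[ℓ]) with hL
  set D : Matrix (Fin 2) (Fin 2) ℤ_[ℓ] := Matrix.diagonal ![L ^ 0, L ^ (0 + n)] with hD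
  have hY' : ∀ γ, ∃ Y : Matrix (Fin 2) (Fin 2) ℤ_[ℓ], ρ γ = 1 + D * Y := fun γ ↦
    (exists_eq_one_add_diagonal_mul_iff 0 (0 + n) (ρ γ)).mpr (hshape γ)
  choose Y hY using hY'
  -- the composition law and `Y(1) = 0`
  have hcomp : ∀ γ δ, Y (γ * δ) = Y γ + Y δ + Y γ * D * Y δ := by
    intro γ δ
    apply diagonal_pow_mul_injective 0 (0 + n)
    rw [← hD]
    have h := hY (γ * δ)
    rw [map_mul, hY γ, hY δ] at h
    have h2 : (1 + D * Y γ) * (1 + D * Y δ) = 1 + D * (Y γ + Y δ + Y γ * D * Y δ) := by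
      noncomm_ring
    exact add_left_cancel (h2.symm.trans h).symm
  have hY1 : Y 1 = 0 := by
    apply diagonal_pow_mul_injective 0 (0 + n)
    rw [← hD, Matrix.mul_zero]
    have h := hY 1
    rw [map_one] at h
    exact (add_eq_left.mp h.symm)
  have hL0 : toZMod (p := ℓ) L = 0 := by rw [hL, map_natCast, ZMod.natCast_self]
  -- the four laws modulo `ℓ`
  have hent : ∀ γ δ (i j : Fin 2), toZMod (p := ℓ) (Y (γ * δ) i j) =
      toZMod (Y γ i j) + toZMod (Y δ i j) + toZMod (Y γ i 0) * toZMod (Y δ 0 j) := by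
    intro γ δ i j
    have h := congrArg (fun M : Matrix (Fin 2) (Fin 2) ℤ_[ℓ] ↦ toZMod (p := ℓ) (M i j))
      (hcomp γ δ)
    simp only [Matrix.add_apply, map_add] at h
    rw [h, add_right_inj, hD]
    have hn0 : n ≠ 0 := by omega
    simp [Matrix.mul_apply, Fin.sum_univ_two, Matrix.diagonal, hL0, hn0]
  have h1 : toZMod (p := ℓ) (Y 1 0 0) = 0 := by rw [hY1]; simp
  have hdet0 : ∀ γ, toZMod (p := ℓ) (Y γ 0 0) * toZMod (Y γ 1 1) =
      toZMod (Y γ 0 1) * toZMod (Y γ 1 0) := by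
    intro γ
    have h2 := hdet γ
    rw [hY γ, hD, det_one_sub_one_add_diagonal_mul, pow_succ] at h2
    have h3 : toZMod (p := ℓ) (Y γ).det = 0 := by
      rw [toZMod_eq_zero_iff_dvd]
      exact (mul_dvd_mul_iff_left (pow_ne_zero _ hl)).mp h2
    rw [Matrix.det_fin_two, map_sub, map_mul, map_mul] at h3
    exact sub_eq_zero.mp h3
  have hmap : ∀ γ (i j : Fin 2), (toZMod (p := ℓ)).mapMatrix (Y γ) i j = toZMod (Y γ i j) :=
    fun γ i j ↦ rfl
  rcases borel_four_functions (fun γ ↦ toZMod (p := ℓ) (Y γ 0 0)) (fun γ ↦ toZMod (Y γ 0 1))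
      (fun γ ↦ toZMod (Y γ 1 0)) (fun γ ↦ toZMod (Y γ 1 1)) (fun γ δ ↦ hent γ δ 0 0)
      (fun γ δ ↦ hent γ δ 0 1) (fun γ δ ↦ hent γ δ 1 0) (fun γ δ ↦ hent γ δ 1 1) h1 hdet0 with
    hac | hab | ⟨x, hx⟩ | ⟨e, he⟩
  · -- kernel vector `(1, 0)`
    refine step_of_dichotomy hY (Or.inl ⟨![1, 0], fun h ↦ by simpa using congrFun h 0,
      fun γ ↦ ?_⟩)
    have ha0 : toZMod (p := ℓ) (Y γ 0 0) = 0 := (hac γ).1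
    have hc0 : toZMod (p := ℓ) (Y γ 1 0) = 0 := (hac γ).2
    ext i
    fin_cases i <;> simp [Matrix.mulVec, dotProduct, hmap, ha0, hc0]
  · -- cokernel vector `(1, 0)`
    refine step_of_dichotomy hY (Or.inr ⟨![1, 0], fun h ↦ by simpa using congrFun h 0,
      fun γ ↦ ?_⟩)
    have ha0 : toZMod (p := ℓ) (Y γ 0 0) = 0 := (hab γ).1
    have hb0 : toZMod (p := ℓ) (Y γ 0 1) = 0 := (hab γ).2
    ext j
    fin_cases j <;> simp [Matrix.vecMul, dotProduct, hmap, ha0, hb0]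
  · -- kernel vector `(x, 1)`
    refine step_of_dichotomy hY (Or.inl ⟨![x, 1], fun h ↦ by simpa using congrFun h 1,
      fun γ ↦ ?_⟩)
    have hx0 : x * toZMod (p := ℓ) (Y γ 0 0) + toZMod (Y γ 0 1) = 0 := (hx γ).1
    have hx1 : x * toZMod (p := ℓ) (Y γ 1 0) + toZMod (Y γ 1 1) = 0 := (hx γ).2
    ext i
    fin_cases i
    · simp [Matrix.mulVec, dotProduct, hmap]
      linear_combination hx0
    · simp [Matrix.mulVec, dotProduct, hmap]
      linear_combination hx1
  · -- cokernel vector `(−e, 1)`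
    refine step_of_dichotomy hY (Or.inr ⟨![-e, 1], fun h ↦ by simpa using congrFun h 1,
      fun γ ↦ ?_⟩)
    have he0 : toZMod (p := ℓ) (Y γ 1 0) = e * toZMod (Y γ 0 0) := (he γ).1
    have he1 : toZMod (p := ℓ) (Y γ 1 1) = e * toZMod (Y γ 0 1) := (he γ).2
    ext j
    fin_cases j
    · simp [Matrix.vecMul, dotProduct, hmap]
      linear_combination he0
    · simp [Matrix.vecMul, dotProduct, hmap]
      linear_combination he1

/-- **The base case `(0, 0)` of the inductive step** (`n = 0 → 1`): if `ℓ ∣ det(1 − ρ γ)` for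
all `γ`, then `ρ̄ = ρ mod ℓ` has a common fixed vector or a common fixed covector
(`exists_common_fixed_or_cofixed`), i.e. `Ȳ = ρ̄ − 1` has a common kernel or cokernel vector, and
one of the four moves applies (with `a = k = 0`). [cite: Katz1980, Thm. 1 (proof)] -/
theorem step_base {ρ : Γ →* Matrix (Fin 2) (Fin 2) ℤ_[ℓ]}
    (hdet : ∀ γ, (ℓ : ℤ_[ℓ]) ∣ (1 - ρ γ).det) :
    ∃ (Q : Matrix (Fin 2) (Fin 2) ℤ_[ℓ]) (a' b' : ℕ), Q.det ≠ 0 ∧ a' + b' = 1 ∧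
      ∀ γ, ∃ X : Matrix (Fin 2) (Fin 2) ℤ_[ℓ], ρ γ * Q = Q * X ∧
        ((ℓ : ℤ_[ℓ]) ^ a' ∣ X 0 0 - 1 ∧ (ℓ : ℤ_[ℓ]) ^ a' ∣ X 0 1 ∧
          (ℓ : ℤ_[ℓ]) ^ b' ∣ X 1 0 ∧ (ℓ : ℤ_[ℓ]) ^ b' ∣ X 1 1 - 1) := by
  classical
  -- `ρ γ = 1 + diag(ℓ⁰, ℓ⁰) (ρ γ − 1)`
  have hD1 : Matrix.diagonal ![(ℓ : ℤ_[ℓ]) ^ 0, (ℓ : ℤ_[ℓ]) ^ (0 + 0)] = 1 := by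
    ext i j
    fin_cases i <;> fin_cases j <;> simp
  have hY : ∀ γ, ρ γ = 1 + Matrix.diagonal ![(ℓ : ℤ_[ℓ]) ^ 0, (ℓ : ℤ_[ℓ]) ^ (0 + 0)] *
      (ρ γ - 1) := fun γ ↦ by
    rw [hD1, Matrix.one_mul, add_sub_cancel]
  -- reduction modulo `ℓ`
  let ρb : Γ →* Matrix (Fin 2) (Fin 2) (ZMod ℓ) := (toZMod (p := ℓ)).mapMatrix.toMonoidHom.comp ρ
  have hρb : ∀ γ, ρb γ = (toZMod (p := ℓ)).mapMatrix (ρ γ) := fun γ ↦ rfl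
  have hsub : ∀ γ, (toZMod (p := ℓ)).mapMatrix (ρ γ - 1) = ρb γ - 1 := fun γ ↦ by
    rw [map_sub, map_one, hρb]
  have hdet0 : ∀ γ, (1 - ρb γ).det = 0 := by
    intro γ
    have h1 : 1 - ρb γ = (toZMod (p := ℓ)).mapMatrix (1 - ρ γ) := by
      rw [map_sub, map_one, hρb]
    rw [h1, ← RingHom.map_det, toZMod_eq_zero_iff_dvd]
    exact hdet γ
  have h : (∃ x : Fin 2 → ZMod ℓ, x ≠ 0 ∧
        ∀ γ, (toZMod (p := ℓ)).mapMatrix (ρ γ - 1) *ᵥ x = 0) ∨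
      (∃ w : Fin 2 → ZMod ℓ, w ≠ 0 ∧ ∀ γ, w ᵥ* (toZMod (p := ℓ)).mapMatrix (ρ γ - 1) = 0) := by
    rcases exists_common_fixed_or_cofixed ρb hdet0 with ⟨x, hx0, hx⟩ | ⟨w, hw0, hw⟩
    · exact Or.inl ⟨x, hx0, fun γ ↦ by
        rw [hsub, Matrix.sub_mulVec, Matrix.one_mulVec, hx γ, sub_self]⟩
    · exact Or.inr ⟨w, hw0, fun γ ↦ by
        rw [hsub, Matrix.vecMul_sub, Matrix.vecMul_one, hw γ, sub_self]⟩
  obtain ⟨Q, a', b', hQ, hab, hX⟩ := step_of_dichotomy hY h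
  exact ⟨Q, a', b', hQ, by omega, hX⟩

/-- The inductive step for shapes `(a, a + k)` (all cases `a = k = 0`, `a = 0 < k`, `a ≥ 1`). [cite: Katz1980, Thm. 1 (proof)] -/
theorem step_le {ρ : Γ →* Matrix (Fin 2) (Fin 2) ℤ_[ℓ]} {a k : ℕ}
    (hshape : ∀ γ, (ℓ : ℤ_[ℓ]) ^ a ∣ ρ γ 0 0 - 1 ∧ (ℓ : ℤ_[ℓ]) ^ a ∣ ρ γ 0 1 ∧
      (ℓ : ℤ_[ℓ]) ^ (a + k) ∣ ρ γ 1 0 ∧ (ℓ : ℤ_[ℓ]) ^ (a + k) ∣ ρ γ 1 1 - 1)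
    (hdet : ∀ γ, (ℓ : ℤ_[ℓ]) ^ (a + (a + k) + 1) ∣ (1 - ρ γ).det) :
    ∃ (Q : Matrix (Fin 2) (Fin 2) ℤ_[ℓ]) (a' b' : ℕ), Q.det ≠ 0 ∧ a' + b' = a + (a + k) + 1 ∧
      ∀ γ, ∃ X : Matrix (Fin 2) (Fin 2) ℤ_[ℓ], ρ γ * Q = Q * X ∧
        ((ℓ : ℤ_[ℓ]) ^ a' ∣ X 0 0 - 1 ∧ (ℓ : ℤ_[ℓ]) ^ a' ∣ X 0 1 ∧
          (ℓ : ℤ_[ℓ]) ^ b' ∣ X 1 0 ∧ (ℓ : ℤ_[ℓ]) ^ b' ∣ X 1 1 - 1) := by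
  rcases Nat.eq_zero_or_pos a with rfl | ha
  · rcases Nat.eq_zero_or_pos k with rfl | hk
    · obtain ⟨Q, a', b', hQ, hab, hX⟩ := step_base (ρ := ρ) fun γ ↦ by simpa using hdet γ
      exact ⟨Q, a', b', hQ, by omega, hX⟩
    · exact step_borel hk hshape hdet
  · exact step_add ha hshape hdet

/-- **The inductive step of Katz's theorem.** If `ρ : Γ →* M₂(ℤ_ℓ)` has shape `(a, b)` and
`det(1 − ρ γ) ≡ 0 (mod ℓᵃ⁺ᵇ⁺¹)` for all `γ`, there are `Q` with `det Q ≠ 0` and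
`a' + b' = a + b + 1` such that every `ρ γ · Q = Q · X_γ` with `X_γ` of shape `(a', b')` (the case
`a > b` is reduced to `a ≤ b` by `exists_conj_of_swap`). [cite: Katz1980, Thm. 1 (proof)] -/
theorem step {ρ : Γ →* Matrix (Fin 2) (Fin 2) ℤ_[ℓ]} {a b : ℕ}
    (hshape : ∀ γ, (ℓ : ℤ_[ℓ]) ^ a ∣ ρ γ 0 0 - 1 ∧ (ℓ : ℤ_[ℓ]) ^ a ∣ ρ γ 0 1 ∧
      (ℓ : ℤ_[ℓ]) ^ b ∣ ρ γ 1 0 ∧ (ℓ : ℤ_[ℓ]) ^ b ∣ ρ γ 1 1 - 1)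
    (hdet : ∀ γ, (ℓ : ℤ_[ℓ]) ^ (a + b + 1) ∣ (1 - ρ γ).det) :
    ∃ (Q : Matrix (Fin 2) (Fin 2) ℤ_[ℓ]) (a' b' : ℕ), Q.det ≠ 0 ∧ a' + b' = a + b + 1 ∧
      ∀ γ, ∃ X : Matrix (Fin 2) (Fin 2) ℤ_[ℓ], ρ γ * Q = Q * X ∧
        ((ℓ : ℤ_[ℓ]) ^ a' ∣ X 0 0 - 1 ∧ (ℓ : ℤ_[ℓ]) ^ a' ∣ X 0 1 ∧
          (ℓ : ℤ_[ℓ]) ^ b' ∣ X 1 0 ∧ (ℓ : ℤ_[ℓ]) ^ b' ∣ X 1 1 - 1) := by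
  rcases le_or_gt a b with hab | hab
  · obtain ⟨k, rfl⟩ := Nat.exists_eq_add_of_le hab
    exact step_le hshape hdet
  · obtain ⟨k, rfl⟩ := Nat.exists_eq_add_of_lt hab
    refine exists_conj_of_swap hshape fun ρ' hshape' hdet' ↦ ?_
    have hdet'' : ∀ γ, (ℓ : ℤ_[ℓ]) ^ (b + (b + (k + 1)) + 1) ∣ (1 - ρ' γ).det := fun γ ↦ by
      rw [hdet', show b + (b + (k + 1)) + 1 = b + k + 1 + b + 1 by ring]
      exact hdet γ
    obtain ⟨Q, a', b', hQ, hab', hX⟩ := step_le (a := b) (k := k + 1) hshape' hdet''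
    exact ⟨Q, a', b', hQ, by omega, hX⟩

end Step

/-! ## VII. Katz's theorem -/

section Katz

variable {ℓ : ℕ} [hℓ : Fact ℓ.Prime] {Γ : Type*} [Group Γ]

open PadicInt

/-- **Katz 1981, Theorem 1 (uniform determinant congruences are explained by lattices).** Let
`ℓ` be a prime, `Γ` a group and `ρ : Γ →* M₂(ℤ_ℓ)` a homomorphism (e.g. the action on a stable
lattice of a compact subgroup of `GL₂(ℚ_ℓ)`) such that `det(1 − ρ γ) ≡ 0 (mod ℓⁿ)` for every
`γ ∈ Γ`. Then there are an integral matrix `P` with `det P ≠ 0` and `a, b ≥ 0` with `a + b = n`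
such that in the basis of `ℚ_ℓ²` formed by the columns of `P` every `ρ γ` has the form
`X_γ ∈ (1 + ℓᵃ ℤ_ℓ, ℓᵃ ℤ_ℓ; ℓᵇ ℤ_ℓ, 1 + ℓᵇ ℤ_ℓ)` (`ρ γ · P = P · X_γ`), i.e. the image lies in
Katz's group `G(n; a, b)`: equivalently, the lattices `𝓛 = P ℤ_ℓ² ⊇ 𝓛' = P diag(ℓᵃ, ℓᵇ) ℤ_ℓ²`
are `Γ`-stable with `Γ` acting trivially on `𝓛 / 𝓛' ≅ ℤ/ℓᵃ × ℤ/ℓᵇ`, of order `ℓⁿ`. (Katz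
states it for compact open `G ≤ Aut(V)`, `V` a plane over `ℚ_ℓ`; arXiv:2602.21047, Thm. 3.1, and
Cullinan–Kenney–Voight 2022, Thm. 2.3.1, restate it; the proof is Katz's induction on `n`, one
step being `step`.) [cite: Katz1980, Thm. 1] [cite: CullinanKenneyVoight2022, Thm. 2.3.1] -/
theorem katz_exists_lattice_of_det_one_sub_dvd (ρ : Γ →* Matrix (Fin 2) (Fin 2) ℤ_[ℓ]) (n : ℕ)
    (hdet : ∀ γ, (ℓ : ℤ_[ℓ]) ^ n ∣ (1 - ρ γ).det) :
    ∃ (P : Matrix (Fin 2) (Fin 2) ℤ_[ℓ]) (a b : ℕ), P.det ≠ 0 ∧ a + b = n ∧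
      ∀ γ, ∃ X : Matrix (Fin 2) (Fin 2) ℤ_[ℓ], ρ γ * P = P * X ∧
        ((ℓ : ℤ_[ℓ]) ^ a ∣ X 0 0 - 1 ∧ (ℓ : ℤ_[ℓ]) ^ a ∣ X 0 1 ∧
          (ℓ : ℤ_[ℓ]) ^ b ∣ X 1 0 ∧ (ℓ : ℤ_[ℓ]) ^ b ∣ X 1 1 - 1) := by
  induction n with
  | zero =>
    refine ⟨1, 0, 0, by simp, rfl, fun γ ↦ ⟨ρ γ, by rw [Matrix.mul_one, Matrix.one_mul], ?_⟩⟩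
    simp
  | succ n ih =>
    obtain ⟨P, a, b, hP, hab, hX⟩ := ih fun γ ↦ (pow_dvd_pow _ n.le_succ).trans (hdet γ)
    obtain ⟨ρ', hρ', hdet', huniq⟩ :=
      exists_monoidHom_conj hP fun γ ↦ (hX γ).imp fun X h ↦ h.1
    have hshape' : ∀ γ, (ℓ : ℤ_[ℓ]) ^ a ∣ ρ' γ 0 0 - 1 ∧ (ℓ : ℤ_[ℓ]) ^ a ∣ ρ' γ 0 1 ∧
        (ℓ : ℤ_[ℓ]) ^ b ∣ ρ' γ 1 0 ∧ (ℓ : ℤ_[ℓ]) ^ b ∣ ρ' γ 1 1 - 1 := by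
      intro γ
      obtain ⟨X, hXe, hXs⟩ := hX γ
      rw [huniq γ X hXe]
      exact hXs
    obtain ⟨Q, a', b', hQ, hab', hX'⟩ := step hshape' fun γ ↦ by
      rw [hdet', hab]
      exact hdet γ
    refine ⟨P * Q, a', b', by rw [Matrix.det_mul]; exact mul_ne_zero hP hQ, by omega,
      fun γ ↦ ?_⟩
    obtain ⟨X', hXe', hXs'⟩ := hX' γ
    exact ⟨X', by rw [← Matrix.mul_assoc, hρ', Matrix.mul_assoc, hXe', Matrix.mul_assoc], hXs'⟩

/-- Katz's theorem in the form "`ρ γ · P = P · (1 + diag(ℓᵃ, ℓᵇ) Y_γ)`". [cite: Katz1980, Thm. 1] -/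
theorem katz_exists_lattice_of_det_one_sub_dvd' (ρ : Γ →* Matrix (Fin 2) (Fin 2) ℤ_[ℓ]) (n : ℕ)
    (hdet : ∀ γ, (ℓ : ℤ_[ℓ]) ^ n ∣ (1 - ρ γ).det) :
    ∃ (P : Matrix (Fin 2) (Fin 2) ℤ_[ℓ]) (a b : ℕ), P.det ≠ 0 ∧ a + b = n ∧
      ∀ γ, ∃ Y : Matrix (Fin 2) (Fin 2) ℤ_[ℓ],
        ρ γ * P = P * (1 + Matrix.diagonal ![(ℓ : ℤ_[ℓ]) ^ a, (ℓ : ℤ_[ℓ]) ^ b] * Y) := by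
  obtain ⟨P, a, b, hP, hab, hX⟩ := katz_exists_lattice_of_det_one_sub_dvd ρ n hdet
  refine ⟨P, a, b, hP, hab, fun γ ↦ ?_⟩
  obtain ⟨X, hXe, hXs⟩ := hX γ
  obtain ⟨Y, rfl⟩ := (exists_eq_one_add_diagonal_mul_iff a b X).mpr hXs
  exact ⟨Y, hXe⟩

/-- **The transported homomorphism.** In the situation of Katz's theorem, the action on the
lattice `P ℤ_ℓ²` is a homomorphism `ρ' : Γ →* M₂(ℤ_ℓ)` with `ρ γ · P = P · ρ' γ`, the same
`det(1 − ·)`, and values of shape `(a, b)`, `a + b = n`. [cite: Katz1980, Thm. 1] -/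
theorem katz_exists_monoidHom_of_det_one_sub_dvd (ρ : Γ →* Matrix (Fin 2) (Fin 2) ℤ_[ℓ]) (n : ℕ)
    (hdet : ∀ γ, (ℓ : ℤ_[ℓ]) ^ n ∣ (1 - ρ γ).det) :
    ∃ (P : Matrix (Fin 2) (Fin 2) ℤ_[ℓ]) (a b : ℕ) (ρ' : Γ →* Matrix (Fin 2) (Fin 2) ℤ_[ℓ]),
      P.det ≠ 0 ∧ a + b = n ∧ (∀ γ, ρ γ * P = P * ρ' γ) ∧
        (∀ γ, (1 - ρ' γ).det = (1 - ρ γ).det) ∧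
        ∀ γ, (ℓ : ℤ_[ℓ]) ^ a ∣ ρ' γ 0 0 - 1 ∧ (ℓ : ℤ_[ℓ]) ^ a ∣ ρ' γ 0 1 ∧
          (ℓ : ℤ_[ℓ]) ^ b ∣ ρ' γ 1 0 ∧ (ℓ : ℤ_[ℓ]) ^ b ∣ ρ' γ 1 1 - 1 := by
  obtain ⟨P, a, b, hP, hab, hX⟩ := katz_exists_lattice_of_det_one_sub_dvd ρ n hdet
  obtain ⟨ρ', hρ', hdet', huniq⟩ :=
    exists_monoidHom_conj hP fun γ ↦ (hX γ).imp fun X h ↦ h.1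
  refine ⟨P, a, b, ρ', hP, hab, hρ', hdet', fun γ ↦ ?_⟩
  obtain ⟨X, hXe, hXs⟩ := hX γ
  rw [huniq γ X hXe]
  exact hXs

end Katz

end Literature.NumberTheory.GaloisRepresentations
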